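import Summits.QuantumFields.YangMills.Theorems.FluctuationComparisonRegPrIntLOrganTangentFibreMeanVersionMW
import Summits.QuantumFields.YangMills.Theorems.FluctuationComparisonRegPrIntLOrganTangentAPackageDescendTo
import Literature.MathematicalPhysics.QuantumFieldTheory.Balaban1983to89.BalabanAdmissibleClassParams
import Literature.MathematicalPhysics.QuantumFieldTheory.Balaban1983to89.T4AveragingDisintegration
import Literature.MathematicalPhysics.QuantumFieldTheory.Balaban1983to89.T4CubeChartExp
import Literature.MathematicalPhysics.QuantumFieldTheory.Balaban1983to89.T3MinimiserStabilityReduction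
import HarnessLib

/-!
# ᴱ-EDITION (E) of ✓`…OrganTangentTaylorCutHV22` — RULING №60∕№105 «BACKGROUND WINDOWS»: block ⑤ of the inlined frame texts re-lettered (px8 g25 Φ_h),
# measurability helper re-pointed (SPEC-2); every other byte of statements∕proofs VERBATIM; width seat `ym-ust-20520-w5` g26 pen (LEAD w3 g28 №44), generator `gen_sqE.py`.
# Crux `FluctuationComparisonRegPrIntL` (stmt-QuantumFields-20520, rung R3), PATH-B organ, v18 (H-currency):
# THE TAYLOR CUT, v18.2 EDITION («pW ONLY»: O1ᵘ-H's `∃ pW … pW ≤ p₀ →` HEAD threaded through BOTH antecedents; LEAD `ym-ust-20520-w3` g25 №25 (5)∕№27∕№31 (5), ideator g28 №13, ★★OWNER RULING №71 (2)(iv)∕(3′)) — **O1ᵘ-H v2.2 ⟸ LINᵘ-H″ ∧ JENᵘ-H″** (sibling of ✓p810896 V21 ∕ ✓p804070; DEFINITION-FREE)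

v2.2 EDITION NOTE (width seat `ym3-torus-px13` g22, typed on LEAD w3 g25 №31 (5) «BRICK 1 v2.2 (pW re-lift) … texts fixed … proof = v2.1's + `max pW_L pW_J`
threading as V22»): this file is ✓p810896 `…OrganTangentTaylorCutHV21` with EXACTLY (i) the token pair of ✓px19 g19 `…JunctionDirectTransportV22` applied once to
each of the three texts `hL`, `hJ`, conclusion — `∃ γ₁ : ℝ, 0 < γ₁ ∧` ↦ `∃ pW : ℝ, ∃ γ₁ : ℝ, 0 < γ₁ ∧` and `0 < b₀ → 0 < p₀ → AdmissibleClassParams` ↦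
`0 < b₀ → 0 < p₀ → pW ≤ p₀ → AdmissibleClassParams` — so that `hL` = LINᵘ-H″ (ws16 46d0024cf4aa803f = LEAD's `LinKnit_LEAD_w3g25.TangentUH2` body), `hJ` = JENᵘ-H″
(= JENᵘ-H′ 88c18c31 + the token pair; ws16 ab8fd520a523ae52) and the conclusion = O1ᵘ-H v2.2 = the `hO` binder of ✓V22
`backwardStabilityFinSupH_of_oneStepTransportUH` up to its outer parentheses (ws16 6a04f4fcba6cbbf3); (ii) the proof threads `pW := max pW_L pW_J`
(`obtain ⟨pWL, γL, …⟩`, `obtain ⟨pWJ, γJ, …⟩`, `intro … hp₀ hpW hadm …`, `hpWL∕hpWJ` by `le_max_left∕right`); (iii) the namespace `…TaylorCutHV21` ↦ `…TaylorCutHV22`.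
Nothing else is changed; every docstring sentence below about v18.1∕v2.1 describes the PARENT edition and is kept for provenance.

Cell `ym3-torus` (YM ladder rung R3 = continuum `SU(2)` Yang–Mills on the three-torus — a RUNG: NOT d = 4, NOT infinite volume, NOT a mass gap, NOT Clay).
LEAD-20520 width seat `ym-ust-20520-w3` (gen 25), BRICK 1 of the O1ᵘ-H v2 reduction (★★OWNER g41 WORD №313 (ii); LEAD WORD №1 INTENT + LOCATE 2026-08-31 02:2xZ):
`--kind proof --supports stmt-QuantumFields-20520 --as helper`, count-neutral, no registry ∕ binder ∕ `Lines/` edit (registry `Lines/semiclassical_s2beta.lean`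
v11.4, ★★OWNER RULING №36, untouched; `Lines/runpair_organ.lean` untouched), default heartbeats, `autoImplicit false`.

WHAT THIS IS.  The m-step, H-currency edition of LINE g25-1's ★ junction (`Lines/organ_tangent.lean` v2.6 `oneStepContractionRun_of_tangentCut`, Theorems
✓`…OrganTangentKnitV17.oneStepContractionRun_of_tangentCut` p782786, ✓`…OrganTangentRegularE2EV26` p784599): per CURRENCY-MEMO-g26 §8 «the consumer does not need
iteration», ONE stride of length `m := Ts − j` replaces the single step.  For two class towers `ρ, ρ′` in O1ᵘ-H v2's frame, at a height `j₁ ≤ j < Ts` the discrepancy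
`h_j := log ρ_j − log ρ′_j` is cut BY TAYLOR ORDER on the window: `h_j = mfun + (h_j − mfun)`, where `mfun` is ANY `window_j`-continuous version of the MW-localised
m-step fibre mean `E′[χ_{j,Ts}·h_{Ts}·ρ′_{Ts} ∣ descendTo j Ts = V] ∕ E′[χ_{j,Ts}·ρ′_{Ts} ∣ …]` along ANY disintegration `σ` of product Haar (`χ_{j,Ts}` = the frame's
multi-level-window weight, clause ⑦ iterated — ✓w5 (L18)∕(L19)∕(L20)'s `Finset.range`∕`dite` spelling).  BOTH OBJECTS EXIST BY KERNEL — `σ` by ✓(L16)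
`…OrganTangentAPackageDescendTo.exists_descentDisintegration_descendTo`, `mfun` by ✓(L20) `…OrganTangentFibreMeanVersionMW.exists_height_fibreMeanVersionMW_of_towerCut`
(w5 g22, p800600) — so the junction DISCHARGES them and neither antecedent carries a VERᵐ letter.
* `hL` = **LINᵘ-H** (FIRST ORDER — the m-UNIFORM TANGENT TRANSPORT in Hessian currency): O1ᵘ-H v2's frame and seed H-clause VERBATIM; then for every such `(σ, mfun)`
  a presentation `(c′, a′, w′, k′)` of `mfun` on the `θBal_j∕4`-window with the LINEAR bound `a′ + θ·x′ ≤ (Ctr + εd (T − (Ts+1)))·x + δ j` (no `C`, no `x²`).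
* `hJ` = **JENᵘ-H** (SECOND ORDER — the m-step JENSEN GAP): same frame; a presentation `(c′, a′, w′, k′)` of `h_j − mfun` of the SAME shape (a marginal slot is
  kept, ideator g27 №10 (2): the second-order cumulant has a plaquette-diagonal piece; proofs may take `c′ := 0`) with `a′ + θ·x′ ≤ C·x·x + δ j` (no linear term).
* CONCLUSION = O1ᵘ-H v2 = `Cruxes/…/V18DraftTexts.lean` v0.3 (44402e64e82bae84) `def OneStepTransportUH` BODY with `sfCut`∕`HClauseSq`∕`AnalyticPairWindowAt` INLINED
  and implicit lattice indices `_` — CHARACTER FOR CHARACTER the `hO` binder of ✓px19 g18 `…OrganTangentJunctionDirectTransport.backwardStabilityFinSupH_of_oneStepTransportUH`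
  (ws16 de4191aa1ceaec5a), so `Lines/runpair_organ.lean` v18 could close `stub_oneStepTransportUH` from two smaller named rows by δ-unfolding, should the ideator adopt them.
JUNCTION (v17's proof transposed): `γ₁ := min (min γ₁ᴸ γ₁ᴶ) 1`, `κ₀ θ r w₀ := min`, `j₁ := max (max j₁ᴸ j₁ᴶ) jA` (`jA` = (L20)'s height), `δ := δᴸ + δᴶ` (the floor class is
closed under `+`: `Summable.tsum_add`, `Tendsto.add`), `c′ := c′ᴸ + c′ᴶ`, `a′ := a′ᴸ + a′ᴶ`, `w′ := w′ᴸ + w′ᴶ`, `k′ := k′ᴸ + k′ᴶ` (the marginal is linear in `c′`; the pair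
clause is additive in `(k, R)` and antitone in the cap `r`), and `((Ctr + εd)·x + δᴸ) + (C·x·x + δᴶ) = (Ctr + εd + C·x)·x + δ`; (L20)'s inputs come from the frame: clause ⑦ on `[j, Ts)` in `dU·ρ` form from blocks ⑦ + ⑧, `Measurable (ρ n)`
by un-scaling the `∃ κ`-membership (R-n4) on `[j₀, T]` and a constant tower off it.

HONEST FRAMING: a junction over two HYPOTHESIS SCHEMAS (triangle inequality, `min`∕`max` bookkeeping, the floor class closed under sums); LINᵘ-H and JENᵘ-H are exactly as
OPEN as O1ᵘ-H v2 (the crux of the crux, XL) — nothing of Bałaban's analysis is asserted or proved; S1aᴴ, S2α′, S2β, 26243 OPEN; O1ᵘ-H ∕ crux 20520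
`FluctuationComparisonRegPrIntL` ∕ `YM3TorusSU2` are NOT proved; no summit ∕ sub-problem statement is proved; rung R3 = SU(2) YM₃ on T³ at fixed lattice data — NOT d = 4,
NOT infinite volume, NOT a mass gap, NOT Clay; the Yang–Mills mass gap is NOT proved.  Credit: ideator g25∕g26∕g27 (organ, currency memo, v18 texts), LEAD w3 g22–g24
(spec, census), w5 g22 (MW lane (L15)–(L20)), w4 g21∕g22 (v17 lifts), px19 g18 (def-free lift of the v18 texts); this seat only transposes the cut.

LOCATE (print behind each antecedent; journal pages): LINᵘ-H = the m-UNIFORM localisation of the DIRECT m-step minimal-lift response — T. Bałaban, CMP **102** (1985)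
277–309 [Balaban1985Variational] Thm 1 p.279 (k-step minimal orbit `U_k(V)`, constants «depend on d and L only») and Prop 9 p.309 (analytic dependence on `V`, (190));
CMP **95** (1984) 17–40 [Balaban1984PropagatorsI] Prop 1.2 p.35 (k-uniform exponential decay of `G_k`, `∇G_k`).  JENᵘ-H = the conditional-cumulant ∕ fluctuation-integral
side — CMP **102** (1985) 255–275 [Balaban1985UV3] §3 (41)–(47) pp.266–267, Thm 2 p.272; CMP **109** (1987) 249–301 [Balaban1987RG1] Thm 1 (0.22)–(0.30) pp.256–258;
CMP **98** (1985) 17–51 [Balaban1985Averaging] (10)–(13) p.19 (the averaging ∕ its disintegration).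
-/

set_option autoImplicit false

noncomputable section

namespace Summit.QuantumFields.YangMills.Theorems.OrganTangentTaylorCutHV23

-- ᴱ: px8 g25's Φ_h names lit `iterBlockOf` (the blocks' feet) unqualified
open Literature.MathematicalPhysics.QuantumFieldTheory.Balaban1983to89.B5Eq118OneStroke (iterBlockOf)
open MeasureTheory Filter Topology Function
open scoped ENNReal
open Literature.MathematicalPhysics.QuantumFieldTheory.Balaban1983to89 T3ContinuumYM3Torus T3NestedUnitLaws
  T3UnitLawDensityEML T4Continuum BalabanUVClass T3UnitScaleTilt T3LevelShift T3TiltDescent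
open T4CubeChartExp (expPt)
open Summit.QuantumFields.YangMills.Theorems.FluctuationComparisonRegPrIntLOrganTangentFibreMeanVersionMW
  (exists_height_fibreMeanVersionMW_of_towerCut)
open Summit.QuantumFields.YangMills.Theorems.FluctuationComparisonRegPrIntLOrganTangentAPackageDescendTo
  (exists_descentDisintegration_descendTo)

/-- ★★ **THE TAYLOR CUT IN H-CURRENCY, v18.2 («pW ONLY»): O1ᵘ-H v2.2 ⟸ LINᵘ-H″ ∧ JENᵘ-H″** — the v2.1 theorem below with the `∃ pW … pW ≤ p₀ →` head threaded (`pW := max pW_L pW_J`). PARENT DOCSTRING (v2.1): **THE TAYLOR CUT IN H-CURRENCY, v18.1 (β-window `49∕50·θBal`): O1ᵘ-H v2.1 ⟸ LINᵘ-H′ ∧ JENᵘ-H′** — texts = ✓p804070's with the ONE token family `(θBal … j / 2) ↦ (49 / 50 * θBal … j)` at the block-⑧ (β) sites (42 occurrences); proof byte-identical. (see the module docstring for the texts, the junction and the LOCATE).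
`hL` = LINᵘ-H (m-uniform tangent transport, first order), `hJ` = JENᵘ-H (m-step Jensen gap, second order); conclusion = O1ᵘ-H v2 inlined (= px19's `hO`).
[cite: Balaban1985Variational, Thm 1 p.279 and Prop 9 p.309; Balaban1984PropagatorsI, Prop 1.2 p.35; Balaban1985UV3, (41)-(47) pp.266-267; Balaban1987RG1, Thm 1 (0.22)-(0.30) pp.256-258; Balaban1985Averaging, (10)-(13) p.19] -/
theorem oneStepTransportUH_of_tangentH_jensenH
    (hL : ∃ pW : ℝ, ∃ γ₁ : ℝ, 0 < γ₁ ∧ ∀ (F : T3Family) (γ : ℝ), 0 < γ → γ ≤ γ₁ → ∀ (b₀ p₀ : ℝ) (j₀ : ℕ) (prm : ℕ → ClassParams) (η : ℕ → ℝ) (rA : ℝ) (Bρ : ℕ → ℝ), 0 < b₀ → 0 < p₀ → pW ≤ p₀ → AdmissibleClassParams F γ b₀ p₀ prm → (∀ j, 0 ≤ η j) → Summable η → Summable (fun i => ∑' k, η (k + i)) → Tendsto (fun j => (∑' k, η (k + j)) * ((1 + 2 * ((F.L : ℝ) ^ j / γ) * (Fintype.card (Plaq (F.P j) 0) : ℝ))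 * (Fintype.card (PBond (F.P j) 0) : ℝ) ^ 2)) atTop (𝓝 0) → 0 < rA → ∃ κ₀ : ℝ, 0 < κ₀ ∧ ∀ (κ : ℝ), 0 < κ → κ ≤ κ₀ → ∃ (θ r Ctr w₀ : ℝ) (εd δ : ℕ → ℝ) (j₁ : ℕ), 0 < θ ∧ 0 < r ∧ 1 ≤ Ctr ∧ 0 < w₀ ∧ (∀ j, 0 ≤ εd j ∧ 0 ≤ δ j) ∧ Summable εd ∧ Summable δ ∧ Summable (fun i => ∑' k, δ (k + i)) ∧ Tendsto (fun j => (∑' k, δ (k + j)) * ((1 + 2 * ((F.L : ℝ) ^ j / γ) * (Fintype.card (Plaq (F.P j) 0) : ℝ)) * (Fintype.card (PBond (F.P j) 0) : ℝ) ^ 2)) atTop (𝓝 0) ∧ j₀ ≤ j₁ ∧ ∀ (ν : ℕ → (j : ℕ) → MeasureTheory.Measure (GaugeField (F.P j) 0 ↥(Matrix.specialUnitaryGroup (Fin 2) ℂ))), (∀ K, ν K K = T4GenFunBounds.gibbsMeasure (F.P K) ((F.scheme ℰp γ).β K)) → (∀ K j, j < K → ν K j = Measure.map (descend F ℰp j)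 (ν K (j + 1))) → ∀ (K K' : ℕ), K ≤ K' → ∀ (Ts T : ℕ), Ts < T → T ≤ K → ∀ (μ μ' : ((j : ℕ) → MeasureTheory.Measure (GaugeField (F.P j) 0 ↥(Matrix.specialUnitaryGroup (Fin 2) ℂ)))) (ρ ρ' : ((j : ℕ) → GaugeField (F.P j) 0 ↥(Matrix.specialUnitaryGroup (Fin 2) ℂ) → ℝ)), (∀ j : ℕ, Ts ≤ j → j ≤ T → μ j = ν K j ∧ μ' j = ν K' j) → (∀ j : ℕ, j < Ts → μ j = Measure.map (descend F ℰp j) ((μ (j + 1)).withDensity (fun U => ENNReal.ofReal ((∏ p : Plaq _ _, max 0 (min 1 ((24 / 25 * (θBal F.L γ b₀ p₀ (j + 1)) - dist1 (GaugeField.plaqHol U p)) / ((24 / 25 - 1 / 2) * (θBal F.L γ b₀ p₀ (j + 1))))))))) ∧ μ' j = Measure.map (descend F ℰp j) ((μ' (j + 1)).withDensity (fun U => ENNReal.ofReal ((∏ p : Plaq _ _, max 0 (min 1 ((24 / 25 * (θBal F.L γ b₀ p₀ (j + 1)) - dist1 (GaugeField.plaqHol U p)) / ((24 / 25 - 1 /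 2) * (θBal F.L γ b₀ p₀ (j + 1)))))))))) → (∀ j : ℕ, Ts ≤ j → j < T → μ j = Measure.map (descend F ℰp j) (μ (j + 1)) ∧ μ' j = Measure.map (descend F ℰp j) (μ' (j + 1))) → (∀ j : ℕ, j ≤ T → IsFiniteMeasure (μ j) ∧ IsFiniteMeasure (μ' j)) → (∀ j : ℕ, j₀ ≤ j → j ≤ T → ((∀ U, PlaqSmall (θBal F.L γ b₀ p₀ j) U → 0 < ρ j U ∧ 0 < ρ' j U) ∧ μ j = (fieldMeasure _ _ _).withDensity (fun U => ENNReal.ofReal (ρ j U)) ∧ μ' j = (fieldMeasure _ _ _).withDensity (fun U => ENNReal.ofReal (ρ' j U)) ∧ (∃ (K : ℕ) (hjK : j ≤ K),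
        ∃ κ : ℝ, ∃ (bg : GaugeField (F.P K) (K - j) (Matrix.specialUnitaryGroup (Fin 2) ℂ) → GaugeField (F.P K) 0 (Matrix.specialUnitaryGroup (Fin 2) ℂ))
          (nDom : ℕ) (supp : Fin nDom → Set (PBond (F.P K) 0)) (foot : Fin nDom → Finset (Site (F.P K) (K - j)))
          (len : Fin nDom → ℝ) (wt : Fin nDom → ℝ) (act : Fin nDom → GaugeField (F.P K) 0 (Matrix.specialUnitaryGroup (Fin 2) ℂ) → ℝ)
          (cst : ℝ) (lf : GaugeField (F.P K) (K - j) (Matrix.specialUnitaryGroup (Fin 2) ℂ) → ℝ),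
          (∀ V, 0 ≤ readAtLevel F hjK (fun U => Real.exp κ * ρ j U) V) ∧
          Measurable (readAtLevel F hjK (fun U => Real.exp κ * ρ j U)) ∧
          GaugeField.GaugeInvariant (readAtLevel F hjK (fun U => Real.exp κ * ρ j U)) ∧
          (∀ V, PlaqSmall (prm j).δ V →
            IsBackground (fun i => BlockAveraging.blockAvg (P := F.P K) (j := i) ℰp) {U | PlaqSmall (prm j).δreg U} (K - j) V (bg V)) ∧
          (∀ X, (foot X).Nonempty) ∧ (∀ X b, b ∈ supp X → iterBlockOf (K - j) b.src ∈ foot X) ∧ (∀ X, 0 ≤ len X) ∧ (∀ X, 0 ≤ wt X) ∧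
          (∀ X, ∀ y ∈ foot X, ∀ y' ∈ foot X, (Site.tdist y y' : ℝ) ≤ (prm j).M * (len X + 1)) ∧
          (∀ X (U U' : GaugeField (F.P K) 0 (Matrix.specialUnitaryGroup (Fin 2) ℂ)), (∀ b ∈ supp X, U b = U' b) → act X U = act X U') ∧
          (∀ X, GaugeField.GaugeInvariant (act X)) ∧
          (∀ X V, PlaqSmall (prm j).δ V → PlaqSmall ((prm j).δ * ((F.L : ℝ)⁻¹) ^ (2 * (K - j))) (bg V) →
            |act X (bg V)| ≤ wt X * Real.exp (-((prm j).κ * len X))) ∧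
          (∀ y : Site (F.P K) (K - j), ∑ X ∈ Finset.univ.filter (fun X => y ∈ foot X), wt X * Real.exp (-((prm j).κ * len X)) ≤ (prm j).Ccov) ∧
          |cst| ≤ (prm j).cE * Fintype.card (Site (F.P K) (K - j)) ∧
          (∀ V, PlaqSmall (prm j).δ V → PlaqSmall ((prm j).δ * ((F.L : ℝ)⁻¹) ^ (2 * (K - j))) (bg V) →
            Real.exp (-((prm j).β * wilsonAction4 (bg V)) + (∑ X, act X (bg V)) + cst - (prm j).slack) ≤ readAtLevel F hjK (fun U => Real.exp κ * ρ j U) V) ∧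
          (∀ V, PlaqSmall (prm j).δ V → PlaqSmall ((prm j).δ * ((F.L : ℝ)⁻¹) ^ (2 * (K - j))) (bg V) →
            readAtLevel F hjK (fun U => Real.exp κ * ρ j U) V ≤ Real.exp (-((prm j).β * wilsonAction4 (bg V)) + (∑ X, act X (bg V)) + cst + (prm j).slack) + lf V) ∧
          (∀ V, 0 ≤ lf V) ∧ (∀ V, lf V ≤ Real.exp (-(prm j).cLF) * Real.exp ((prm j).c5 * Fintype.card (Site (F.P K) (K - j)))) ∧
          (∀ V (S : Finset (Plaq (F.P K) (K - j))), (∀ p ∈ S, (prm j).δL ≤ dist1 (GaugeField.plaqHol V p)) →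
            readAtLevel F hjK (fun U => Real.exp κ * ρ j U) V ≤ Real.exp (-((prm j).cLF * S.card)) * Real.exp ((prm j).c5 * Fintype.card (Site (F.P K) (K - j))))) ∧ (∃ (K : ℕ) (hjK : j ≤ K),
        ∃ κ : ℝ, ∃ (bg : GaugeField (F.P K) (K - j) (Matrix.specialUnitaryGroup (Fin 2) ℂ) → GaugeField (F.P K) 0 (Matrix.specialUnitaryGroup (Fin 2) ℂ))
          (nDom : ℕ) (supp : Fin nDom → Set (PBond (F.P K) 0)) (foot : Fin nDom → Finset (Site (F.P K) (K - j)))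
          (len : Fin nDom → ℝ) (wt : Fin nDom → ℝ) (act : Fin nDom → GaugeField (F.P K) 0 (Matrix.specialUnitaryGroup (Fin 2) ℂ) → ℝ)
          (cst : ℝ) (lf : GaugeField (F.P K) (K - j) (Matrix.specialUnitaryGroup (Fin 2) ℂ) → ℝ),
          (∀ V, 0 ≤ readAtLevel F hjK (fun U => Real.exp κ * ρ' j U) V) ∧
          Measurable (readAtLevel F hjK (fun U => Real.exp κ * ρ' j U)) ∧
          GaugeField.GaugeInvariant (readAtLevel F hjK (fun U => Real.exp κ * ρ' j U)) ∧
          (∀ V, PlaqSmall (prm j).δ V →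
            IsBackground (fun i => BlockAveraging.blockAvg (P := F.P K) (j := i) ℰp) {U | PlaqSmall (prm j).δreg U} (K - j) V (bg V)) ∧
          (∀ X, (foot X).Nonempty) ∧ (∀ X b, b ∈ supp X → iterBlockOf (K - j) b.src ∈ foot X) ∧ (∀ X, 0 ≤ len X) ∧ (∀ X, 0 ≤ wt X) ∧
          (∀ X, ∀ y ∈ foot X, ∀ y' ∈ foot X, (Site.tdist y y' : ℝ) ≤ (prm j).M * (len X + 1)) ∧
          (∀ X (U U' : GaugeField (F.P K) 0 (Matrix.specialUnitaryGroup (Fin 2) ℂ)), (∀ b ∈ supp X, U b = U' b) → act X U = act X U') ∧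
          (∀ X, GaugeField.GaugeInvariant (act X)) ∧
          (∀ X V, PlaqSmall (prm j).δ V → PlaqSmall ((prm j).δ * ((F.L : ℝ)⁻¹) ^ (2 * (K - j))) (bg V) →
            |act X (bg V)| ≤ wt X * Real.exp (-((prm j).κ * len X))) ∧
          (∀ y : Site (F.P K) (K - j), ∑ X ∈ Finset.univ.filter (fun X => y ∈ foot X), wt X * Real.exp (-((prm j).κ * len X)) ≤ (prm j).Ccov) ∧
          |cst| ≤ (prm j).cE * Fintype.card (Site (F.P K) (K - j)) ∧
          (∀ V, PlaqSmall (prm j).δ V → PlaqSmall ((prm j).δ * ((F.L : ℝ)⁻¹) ^ (2 * (K - j))) (bg V) →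
            Real.exp (-((prm j).β * wilsonAction4 (bg V)) + (∑ X, act X (bg V)) + cst - (prm j).slack) ≤ readAtLevel F hjK (fun U => Real.exp κ * ρ' j U) V) ∧
          (∀ V, PlaqSmall (prm j).δ V → PlaqSmall ((prm j).δ * ((F.L : ℝ)⁻¹) ^ (2 * (K - j))) (bg V) →
            readAtLevel F hjK (fun U => Real.exp κ * ρ' j U) V ≤ Real.exp (-((prm j).β * wilsonAction4 (bg V)) + (∑ X, act X (bg V)) + cst + (prm j).slack) + lf V) ∧
          (∀ V, 0 ≤ lf V) ∧ (∀ V, lf V ≤ Real.exp (-(prm j).cLF) * Real.exp ((prm j).c5 * Fintype.card (Site (F.P K) (K - j)))) ∧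
          (∀ V (S : Finset (Plaq (F.P K) (K - j))), (∀ p ∈ S, (prm j).δL ≤ dist1 (GaugeField.plaqHol V p)) →
            readAtLevel F hjK (fun U => Real.exp κ * ρ' j U) V ≤ Real.exp (-((prm j).cLF * S.card)) * Real.exp ((prm j).c5 * Fintype.card (Site (F.P K) (K - j))))) ∧ μ j {U | ¬ PlaqSmall (θBal F.L γ b₀ p₀ j) U} ≤ ENNReal.ofReal (η j) ∧ μ' j {U | ¬ PlaqSmall (θBal F.L γ b₀ p₀ j) U} ≤ ENNReal.ofReal (η j) ∧ (ContinuousOn (ρ j) {U | PlaqSmall (θBal F.L γ b₀ p₀ j) U} ∧ ContinuousOn (ρ' j) {U | PlaqSmall (θBal F.L γ b₀ p₀ j) U}) ∧ ((∀ (U : GaugeField _ _ ↥(Matrix.specialUnitaryGroup (Fin 2) ℂ)), PlaqSmall (49 / 50 * θBal F.L γ b₀ p₀ j) U → ∀ (b b' : PBond _ _) (v v' : Fin 3 → ℝ), ‖v‖ ≤ 1 → ‖v'‖ ≤ 1 → ∃ g : ℂ × ℂ → ℂ, DifferentiableOn ℂ g (Metric.ball (0 : ℂ) (rA * (49 / 50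 * θBal F.L γ b₀ p₀ j)) ×ˢ Metric.ball (0 : ℂ) (rA * (49 / 50 * θBal F.L γ b₀ p₀ j))) ∧ (∀ (s t : ℝ) (V Z : GaugeField _ _ ↥(Matrix.specialUnitaryGroup (Fin 2) ℂ)), |s| < rA * (49 / 50 * θBal F.L γ b₀ p₀ j) → |t| < rA * (49 / 50 * θBal F.L γ b₀ p₀ j) → (∀ e, e ≠ b → V e = U e) → V b = U b * expPt (s • v) → (∀ e, e ≠ b' → Z e = V e) → Z b' = V b' * expPt (t • v') → g ((s : ℂ), (t : ℂ)) = (((Real.log (ρ j Z)) : ℝ) : ℂ)) ∧ ∀ z ∈ Metric.ball (0 : ℂ) (rA * (49 / 50 * θBal F.L γ b₀ p₀ j)) ×ˢ Metric.ball (0 : ℂ) (rA * (49 / 50 * θBal F.L γ b₀ p₀ j)), ‖g z - g 0‖ ≤ (Bρ j)) ∧ (∀ (U : GaugeField _ _ ↥(Matrix.specialUnitaryGroup (Fin 2) ℂ)), PlaqSmall (49 / 50 * θBal F.L γ b₀ p₀ j) U → ∀ (b b' : PBond _ _) (v v' : Fin 3 → ℝ), ‖v‖ ≤ 1 → ‖v'‖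 ≤ 1 → ∃ g : ℂ × ℂ → ℂ, DifferentiableOn ℂ g (Metric.ball (0 : ℂ) (rA * (49 / 50 * θBal F.L γ b₀ p₀ j)) ×ˢ Metric.ball (0 : ℂ) (rA * (49 / 50 * θBal F.L γ b₀ p₀ j))) ∧ (∀ (s t : ℝ) (V Z : GaugeField _ _ ↥(Matrix.specialUnitaryGroup (Fin 2) ℂ)), |s| < rA * (49 / 50 * θBal F.L γ b₀ p₀ j) → |t| < rA * (49 / 50 * θBal F.L γ b₀ p₀ j) → (∀ e, e ≠ b → V e = U e) → V b = U b * expPt (s • v) → (∀ e, e ≠ b' → Z e = V e) → Z b' = V b' * expPt (t • v') → g ((s : ℂ), (t : ℂ)) = (((Real.log (ρ' j Z)) : ℝ) : ℂ)) ∧ ∀ z ∈ Metric.ball (0 : ℂ) (rA * (49 / 50 * θBal F.L γ b₀ p₀ j)) ×ˢ Metric.ball (0 : ℂ) (rA * (49 / 50 * θBal F.L γ b₀ p₀ j)), ‖g z - g 0‖ ≤ (Bρ j))))) → ∀ (w : ℝ), 0 ≤ w → w / (((F.L : ℝ) ^ Ts / γ) * θBal F.L γ b₀ p₀ Ts ^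 2) ≤ w₀ → (∃ k : PBond (F.P Ts) 0 → PBond (F.P Ts) 0 → ℝ, (∀ b b', 0 ≤ k b b') ∧ (∀ b, ∑ b', k b b' * Real.exp (κ * (b.src.tdist b'.src : ℝ)) ≤ w) ∧ (∀ (b b' : PBond _ _) (v v' : Fin 3 → ℝ) (U V W Z : GaugeField _ _ ↥(Matrix.specialUnitaryGroup (Fin 2) ℂ)), ‖v‖ ≤ (rA / 2) * (θBal F.L γ b₀ p₀ Ts / 4) → ‖v'‖ ≤ (rA / 2) * (θBal F.L γ b₀ p₀ Ts / 4) → PlaqSmall (θBal F.L γ b₀ p₀ Ts / 4) U → PlaqSmall (θBal F.L γ b₀ p₀ Ts / 4) V → PlaqSmall (θBal F.L γ b₀ p₀ Ts / 4) W → PlaqSmall (θBal F.L γ b₀ p₀ Ts / 4) Z → (∀ e, e ≠ b → V e = U e) → V b = U b * expPt v → (∀ e, e ≠ b' → W e = U e) → W b' = U b' * expPt v' → (∀ e, e ≠ b' → Z e = V e) → Z b' = V b' * expPt v' → |(Real.log (ρ Ts Z) - Real.log (ρ' Ts Z)) - (Real.log (ρ Ts V) - Real.log (ρ' Ts V)) -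 (Real.log (ρ Ts W) - Real.log (ρ' Ts W)) + (Real.log (ρ Ts U) - Real.log (ρ' Ts U))| ≤ k b b' * (‖v‖ / (θBal F.L γ b₀ p₀ Ts / 4)) * (‖v'‖ / (θBal F.L γ b₀ p₀ Ts / 4)))) → ∀ (j : ℕ), j₁ ≤ j → ∀ (hjTs : j + 1 ≤ Ts), ∀ (σ : ProbabilityTheory.Kernel (GaugeField (F.P j) 0 ↥(Matrix.specialUnitaryGroup (Fin 2) ℂ)) (GaugeField (F.P Ts) 0 ↥(Matrix.specialUnitaryGroup (Fin 2) ℂ))), ProbabilityTheory.IsMarkovKernel σ → (Measure.map (descendTo F ℰp j Ts (Nat.le_of_succ_le hjTs)) (fieldMeasure (F.P Ts) 0 ↥(Matrix.specialUnitaryGroup (Fin 2) ℂ))).bind ⇑σ = fieldMeasure (F.P Ts) 0 ↥(Matrix.specialUnitaryGroup (Fin 2) ℂ) → (∀ᵐ V ∂(Measure.map (descendTo F ℰp j Ts (Nat.le_of_succ_le hjTs)) (fieldMeasure (F.P Ts) 0 ↥(Matrix.specialUnitaryGroup (Fin 2) ℂ))), ∀ᵐ U ∂(σ V), descendTo F ℰp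 j Ts (Nat.le_of_succ_le hjTs) U = V) → ∀ (mfun : GaugeField (F.P j) 0 ↥(Matrix.specialUnitaryGroup (Fin 2) ℂ) → ℝ), ContinuousOn mfun {V | PlaqSmall (θBal F.L γ b₀ p₀ j) V} → (∀ᵐ V ∂(fieldMeasure (F.P j) 0 ↥(Matrix.specialUnitaryGroup (Fin 2) ℂ)), PlaqSmall (θBal F.L γ b₀ p₀ j) V → MeasureTheory.Integrable (fun U => (∏ i ∈ Finset.range (Ts - j), (if h : j + 1 + i ≤ Ts then (∏ p : Plaq (F.P (j + 1 + i)) 0, max 0 (min 1 ((24 / 25 * θBal F.L γ b₀ p₀ (j + 1 + i) - dist1 (GaugeField.plaqHol (descendTo F ℰp (j + 1 + i) Ts h U) p)) / ((24 / 25 - 1 / 2) * θBal F.L γ b₀ p₀ (j + 1 + i))))) else 1)) * (Real.log (ρ Ts U) - Real.log (ρ' Ts U)) * ρ' Ts U) (σ V) ∧ mfun V = (∫ U, (∏ i ∈ Finset.range (Ts - j), (if h : j + 1 + i ≤ Ts then (∏ p : Plaq (F.P (j + 1 + i)) 0, max 0 (min 1 ((24 / 25 * θBal F.L γ b₀ p₀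 (j + 1 + i) - dist1 (GaugeField.plaqHol (descendTo F ℰp (j + 1 + i) Ts h U) p)) / ((24 / 25 - 1 / 2) * θBal F.L γ b₀ p₀ (j + 1 + i))))) else 1)) * (Real.log (ρ Ts U) - Real.log (ρ' Ts U)) * ρ' Ts U ∂(σ V)) / (∫ U, (∏ i ∈ Finset.range (Ts - j), (if h : j + 1 + i ≤ Ts then (∏ p : Plaq (F.P (j + 1 + i)) 0, max 0 (min 1 ((24 / 25 * θBal F.L γ b₀ p₀ (j + 1 + i) - dist1 (GaugeField.plaqHol (descendTo F ℰp (j + 1 + i) Ts h U) p)) / ((24 / 25 - 1 / 2) * θBal F.L γ b₀ p₀ (j + 1 + i))))) else 1)) * ρ' Ts U ∂(σ V))) → ∃ (c' : Plaq (F.P j) 0 → ℝ) (a' w' : ℝ), 0 ≤ a' ∧ 0 ≤ w' ∧ a' + θ * (w' / (((F.L : ℝ) ^ j / γ) * θBal F.L γ b₀ p₀ j ^ 2)) ≤ (Ctr + εd (T - (Ts + 1))) * (w / (((F.L : ℝ) ^ Ts / γ) * θBal F.L γ b₀ p₀ Ts ^ 2)) + δ j ∧ (∀ p, |c' p| ≤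 a') ∧ ∃ k' : PBond (F.P j) 0 → PBond (F.P j) 0 → ℝ, (∀ b b', 0 ≤ k' b b') ∧ (∀ b, ∑ b', k' b b' * Real.exp (κ * (b.src.tdist b'.src : ℝ)) ≤ w') ∧ (∀ (b b' : PBond _ _) (v v' : Fin 3 → ℝ) (U V W Z : GaugeField _ _ ↥(Matrix.specialUnitaryGroup (Fin 2) ℂ)), ‖v‖ ≤ r * (θBal F.L γ b₀ p₀ j / 4) → ‖v'‖ ≤ r * (θBal F.L γ b₀ p₀ j / 4) → PlaqSmall (θBal F.L γ b₀ p₀ j / 4) U → PlaqSmall (θBal F.L γ b₀ p₀ j / 4) V → PlaqSmall (θBal F.L γ b₀ p₀ j / 4) W → PlaqSmall (θBal F.L γ b₀ p₀ j / 4) Z → (∀ e, e ≠ b → V e = U e) → V b = U b * expPt v → (∀ e, e ≠ b' → W e = U e) → W b' = U b' * expPt v' → (∀ e, e ≠ b' → Z e = V e) → Z b' = V b' * expPt v' → |(mfun Z - ((F.L : ℝ) ^ j / γ) * ∑ p, c' p * (1 - reTr (GaugeField.plaqHol Z p))) - (mfun V - ((F.L : ℝ) ^ j / γ) * ∑ p,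 c' p * (1 - reTr (GaugeField.plaqHol V p))) - (mfun W - ((F.L : ℝ) ^ j / γ) * ∑ p, c' p * (1 - reTr (GaugeField.plaqHol W p))) + (mfun U - ((F.L : ℝ) ^ j / γ) * ∑ p, c' p * (1 - reTr (GaugeField.plaqHol U p)))| ≤ k' b b' * (‖v‖ / (θBal F.L γ b₀ p₀ j / 4)) * (‖v'‖ / (θBal F.L γ b₀ p₀ j / 4))))
    (hJ : ∃ pW : ℝ, ∃ γ₁ : ℝ, 0 < γ₁ ∧ ∀ (F : T3Family) (γ : ℝ), 0 < γ → γ ≤ γ₁ → ∀ (b₀ p₀ : ℝ) (j₀ : ℕ) (prm : ℕ → ClassParams) (η : ℕ → ℝ) (rA : ℝ) (Bρ : ℕ → ℝ), 0 < b₀ → 0 < p₀ → pW ≤ p₀ → AdmissibleClassParams F γ b₀ p₀ prm → (∀ j, 0 ≤ η j) → Summable η → Summable (fun i => ∑' k, η (k + i)) → Tendsto (fun j => (∑' k, η (k + j)) * ((1 + 2 * ((F.L : ℝ) ^ j / γ) * (Fintype.card (Plaq (F.P j) 0) : ℝ)) * (Fintype.card (PBond (F.P j) 0) : ℝ) ^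 2)) atTop (𝓝 0) → 0 < rA → ∃ κ₀ : ℝ, 0 < κ₀ ∧ ∀ (κ : ℝ), 0 < κ → κ ≤ κ₀ → ∃ (θ r C w₀ : ℝ) (δ : ℕ → ℝ) (j₁ : ℕ), 0 < θ ∧ 0 < r ∧ 0 ≤ C ∧ 0 < w₀ ∧ (∀ j, 0 ≤ δ j) ∧ Summable δ ∧ Summable (fun i => ∑' k, δ (k + i)) ∧ Tendsto (fun j => (∑' k, δ (k + j)) * ((1 + 2 * ((F.L : ℝ) ^ j / γ) * (Fintype.card (Plaq (F.P j) 0) : ℝ)) * (Fintype.card (PBond (F.P j) 0) : ℝ) ^ 2)) atTop (𝓝 0) ∧ j₀ ≤ j₁ ∧ ∀ (ν : ℕ → (j : ℕ) → MeasureTheory.Measure (GaugeField (F.P j) 0 ↥(Matrix.specialUnitaryGroup (Fin 2) ℂ))), (∀ K, ν K K = T4GenFunBounds.gibbsMeasure (F.P K) ((F.scheme ℰp γ).β K)) → (∀ K j, j < K → ν K j = Measure.map (descend F ℰp j) (ν K (j + 1))) → ∀ (K K' : ℕ), K ≤ K' → ∀ (Ts T : ℕ), Ts < T → T ≤ K →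 ∀ (μ μ' : ((j : ℕ) → MeasureTheory.Measure (GaugeField (F.P j) 0 ↥(Matrix.specialUnitaryGroup (Fin 2) ℂ)))) (ρ ρ' : ((j : ℕ) → GaugeField (F.P j) 0 ↥(Matrix.specialUnitaryGroup (Fin 2) ℂ) → ℝ)), (∀ j : ℕ, Ts ≤ j → j ≤ T → μ j = ν K j ∧ μ' j = ν K' j) → (∀ j : ℕ, j < Ts → μ j = Measure.map (descend F ℰp j) ((μ (j + 1)).withDensity (fun U => ENNReal.ofReal ((∏ p : Plaq _ _, max 0 (min 1 ((24 / 25 * (θBal F.L γ b₀ p₀ (j + 1)) - dist1 (GaugeField.plaqHol U p)) / ((24 / 25 - 1 / 2) * (θBal F.L γ b₀ p₀ (j + 1))))))))) ∧ μ' j = Measure.map (descend F ℰp j) ((μ' (j + 1)).withDensity (fun U => ENNReal.ofReal ((∏ p : Plaq _ _, max 0 (min 1 ((24 / 25 * (θBal F.L γ b₀ p₀ (j + 1)) - dist1 (GaugeField.plaqHol U p)) / ((24 / 25 - 1 / 2) * (θBal F.L γ b₀ p₀ (j + 1)))))))))) → (∀ j : ℕ, Ts ≤ j → j < T → μ j =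 Measure.map (descend F ℰp j) (μ (j + 1)) ∧ μ' j = Measure.map (descend F ℰp j) (μ' (j + 1))) → (∀ j : ℕ, j ≤ T → IsFiniteMeasure (μ j) ∧ IsFiniteMeasure (μ' j)) → (∀ j : ℕ, j₀ ≤ j → j ≤ T → ((∀ U, PlaqSmall (θBal F.L γ b₀ p₀ j) U → 0 < ρ j U ∧ 0 < ρ' j U) ∧ μ j = (fieldMeasure _ _ _).withDensity (fun U => ENNReal.ofReal (ρ j U)) ∧ μ' j = (fieldMeasure _ _ _).withDensity (fun U => ENNReal.ofReal (ρ' j U)) ∧ (∃ (K : ℕ) (hjK : j ≤ K),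
        ∃ κ : ℝ, ∃ (bg : GaugeField (F.P K) (K - j) (Matrix.specialUnitaryGroup (Fin 2) ℂ) → GaugeField (F.P K) 0 (Matrix.specialUnitaryGroup (Fin 2) ℂ))
          (nDom : ℕ) (supp : Fin nDom → Set (PBond (F.P K) 0)) (foot : Fin nDom → Finset (Site (F.P K) (K - j)))
          (len : Fin nDom → ℝ) (wt : Fin nDom → ℝ) (act : Fin nDom → GaugeField (F.P K) 0 (Matrix.specialUnitaryGroup (Fin 2) ℂ) → ℝ)
          (cst : ℝ) (lf : GaugeField (F.P K) (K - j) (Matrix.specialUnitaryGroup (Fin 2) ℂ) → ℝ),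
          (∀ V, 0 ≤ readAtLevel F hjK (fun U => Real.exp κ * ρ j U) V) ∧
          Measurable (readAtLevel F hjK (fun U => Real.exp κ * ρ j U)) ∧
          GaugeField.GaugeInvariant (readAtLevel F hjK (fun U => Real.exp κ * ρ j U)) ∧
          (∀ V, PlaqSmall (prm j).δ V →
            IsBackground (fun i => BlockAveraging.blockAvg (P := F.P K) (j := i) ℰp) {U | PlaqSmall (prm j).δreg U} (K - j) V (bg V)) ∧
          (∀ X, (foot X).Nonempty) ∧ (∀ X b, b ∈ supp X → iterBlockOf (K - j) b.src ∈ foot X) ∧ (∀ X, 0 ≤ len X) ∧ (∀ X, 0 ≤ wt X) ∧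
          (∀ X, ∀ y ∈ foot X, ∀ y' ∈ foot X, (Site.tdist y y' : ℝ) ≤ (prm j).M * (len X + 1)) ∧
          (∀ X (U U' : GaugeField (F.P K) 0 (Matrix.specialUnitaryGroup (Fin 2) ℂ)), (∀ b ∈ supp X, U b = U' b) → act X U = act X U') ∧
          (∀ X, GaugeField.GaugeInvariant (act X)) ∧
          (∀ X V, PlaqSmall (prm j).δ V → PlaqSmall ((prm j).δ * ((F.L : ℝ)⁻¹) ^ (2 * (K - j))) (bg V) →
            |act X (bg V)| ≤ wt X * Real.exp (-((prm j).κ * len X))) ∧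
          (∀ y : Site (F.P K) (K - j), ∑ X ∈ Finset.univ.filter (fun X => y ∈ foot X), wt X * Real.exp (-((prm j).κ * len X)) ≤ (prm j).Ccov) ∧
          |cst| ≤ (prm j).cE * Fintype.card (Site (F.P K) (K - j)) ∧
          (∀ V, PlaqSmall (prm j).δ V → PlaqSmall ((prm j).δ * ((F.L : ℝ)⁻¹) ^ (2 * (K - j))) (bg V) →
            Real.exp (-((prm j).β * wilsonAction4 (bg V)) + (∑ X, act X (bg V)) + cst - (prm j).slack) ≤ readAtLevel F hjK (fun U => Real.exp κ * ρ j U) V) ∧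
          (∀ V, PlaqSmall (prm j).δ V → PlaqSmall ((prm j).δ * ((F.L : ℝ)⁻¹) ^ (2 * (K - j))) (bg V) →
            readAtLevel F hjK (fun U => Real.exp κ * ρ j U) V ≤ Real.exp (-((prm j).β * wilsonAction4 (bg V)) + (∑ X, act X (bg V)) + cst + (prm j).slack) + lf V) ∧
          (∀ V, 0 ≤ lf V) ∧ (∀ V, lf V ≤ Real.exp (-(prm j).cLF) * Real.exp ((prm j).c5 * Fintype.card (Site (F.P K) (K - j)))) ∧
          (∀ V (S : Finset (Plaq (F.P K) (K - j))), (∀ p ∈ S, (prm j).δL ≤ dist1 (GaugeField.plaqHol V p)) →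
            readAtLevel F hjK (fun U => Real.exp κ * ρ j U) V ≤ Real.exp (-((prm j).cLF * S.card)) * Real.exp ((prm j).c5 * Fintype.card (Site (F.P K) (K - j))))) ∧ (∃ (K : ℕ) (hjK : j ≤ K),
        ∃ κ : ℝ, ∃ (bg : GaugeField (F.P K) (K - j) (Matrix.specialUnitaryGroup (Fin 2) ℂ) → GaugeField (F.P K) 0 (Matrix.specialUnitaryGroup (Fin 2) ℂ))
          (nDom : ℕ) (supp : Fin nDom → Set (PBond (F.P K) 0)) (foot : Fin nDom → Finset (Site (F.P K) (K - j)))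
          (len : Fin nDom → ℝ) (wt : Fin nDom → ℝ) (act : Fin nDom → GaugeField (F.P K) 0 (Matrix.specialUnitaryGroup (Fin 2) ℂ) → ℝ)
          (cst : ℝ) (lf : GaugeField (F.P K) (K - j) (Matrix.specialUnitaryGroup (Fin 2) ℂ) → ℝ),
          (∀ V, 0 ≤ readAtLevel F hjK (fun U => Real.exp κ * ρ' j U) V) ∧
          Measurable (readAtLevel F hjK (fun U => Real.exp κ * ρ' j U)) ∧
          GaugeField.GaugeInvariant (readAtLevel F hjK (fun U => Real.exp κ * ρ' j U)) ∧
          (∀ V, PlaqSmall (prm j).δ V →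
            IsBackground (fun i => BlockAveraging.blockAvg (P := F.P K) (j := i) ℰp) {U | PlaqSmall (prm j).δreg U} (K - j) V (bg V)) ∧
          (∀ X, (foot X).Nonempty) ∧ (∀ X b, b ∈ supp X → iterBlockOf (K - j) b.src ∈ foot X) ∧ (∀ X, 0 ≤ len X) ∧ (∀ X, 0 ≤ wt X) ∧
          (∀ X, ∀ y ∈ foot X, ∀ y' ∈ foot X, (Site.tdist y y' : ℝ) ≤ (prm j).M * (len X + 1)) ∧
          (∀ X (U U' : GaugeField (F.P K) 0 (Matrix.specialUnitaryGroup (Fin 2) ℂ)), (∀ b ∈ supp X, U b = U' b) → act X U = act X U') ∧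
          (∀ X, GaugeField.GaugeInvariant (act X)) ∧
          (∀ X V, PlaqSmall (prm j).δ V → PlaqSmall ((prm j).δ * ((F.L : ℝ)⁻¹) ^ (2 * (K - j))) (bg V) →
            |act X (bg V)| ≤ wt X * Real.exp (-((prm j).κ * len X))) ∧
          (∀ y : Site (F.P K) (K - j), ∑ X ∈ Finset.univ.filter (fun X => y ∈ foot X), wt X * Real.exp (-((prm j).κ * len X)) ≤ (prm j).Ccov) ∧
          |cst| ≤ (prm j).cE * Fintype.card (Site (F.P K) (K - j)) ∧
          (∀ V, PlaqSmall (prm j).δ V → PlaqSmall ((prm j).δ * ((F.L : ℝ)⁻¹) ^ (2 * (K - j))) (bg V) →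
            Real.exp (-((prm j).β * wilsonAction4 (bg V)) + (∑ X, act X (bg V)) + cst - (prm j).slack) ≤ readAtLevel F hjK (fun U => Real.exp κ * ρ' j U) V) ∧
          (∀ V, PlaqSmall (prm j).δ V → PlaqSmall ((prm j).δ * ((F.L : ℝ)⁻¹) ^ (2 * (K - j))) (bg V) →
            readAtLevel F hjK (fun U => Real.exp κ * ρ' j U) V ≤ Real.exp (-((prm j).β * wilsonAction4 (bg V)) + (∑ X, act X (bg V)) + cst + (prm j).slack) + lf V) ∧
          (∀ V, 0 ≤ lf V) ∧ (∀ V, lf V ≤ Real.exp (-(prm j).cLF) * Real.exp ((prm j).c5 * Fintype.card (Site (F.P K) (K - j)))) ∧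
          (∀ V (S : Finset (Plaq (F.P K) (K - j))), (∀ p ∈ S, (prm j).δL ≤ dist1 (GaugeField.plaqHol V p)) →
            readAtLevel F hjK (fun U => Real.exp κ * ρ' j U) V ≤ Real.exp (-((prm j).cLF * S.card)) * Real.exp ((prm j).c5 * Fintype.card (Site (F.P K) (K - j))))) ∧ μ j {U | ¬ PlaqSmall (θBal F.L γ b₀ p₀ j) U} ≤ ENNReal.ofReal (η j) ∧ μ' j {U | ¬ PlaqSmall (θBal F.L γ b₀ p₀ j) U} ≤ ENNReal.ofReal (η j) ∧ (ContinuousOn (ρ j) {U | PlaqSmall (θBal F.L γ b₀ p₀ j) U} ∧ ContinuousOn (ρ' j) {U | PlaqSmall (θBal F.L γ b₀ p₀ j) U}) ∧ ((∀ (U : GaugeField _ _ ↥(Matrix.specialUnitaryGroup (Fin 2) ℂ)), PlaqSmall (49 / 50 * θBal F.L γ b₀ p₀ j) U → ∀ (b b' : PBond _ _) (v v' : Fin 3 → ℝ), ‖v‖ ≤ 1 → ‖v'‖ ≤ 1 → ∃ g : ℂ × ℂ → ℂ, DifferentiableOn ℂ g (Metric.ball (0 : ℂ) (rA * (49 / 50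 * θBal F.L γ b₀ p₀ j)) ×ˢ Metric.ball (0 : ℂ) (rA * (49 / 50 * θBal F.L γ b₀ p₀ j))) ∧ (∀ (s t : ℝ) (V Z : GaugeField _ _ ↥(Matrix.specialUnitaryGroup (Fin 2) ℂ)), |s| < rA * (49 / 50 * θBal F.L γ b₀ p₀ j) → |t| < rA * (49 / 50 * θBal F.L γ b₀ p₀ j) → (∀ e, e ≠ b → V e = U e) → V b = U b * expPt (s • v) → (∀ e, e ≠ b' → Z e = V e) → Z b' = V b' * expPt (t • v') → g ((s : ℂ), (t : ℂ)) = (((Real.log (ρ j Z)) : ℝ) : ℂ)) ∧ ∀ z ∈ Metric.ball (0 : ℂ) (rA * (49 / 50 * θBal F.L γ b₀ p₀ j)) ×ˢ Metric.ball (0 : ℂ) (rA * (49 / 50 * θBal F.L γ b₀ p₀ j)), ‖g z - g 0‖ ≤ (Bρ j)) ∧ (∀ (U : GaugeField _ _ ↥(Matrix.specialUnitaryGroup (Fin 2) ℂ)), PlaqSmall (49 / 50 * θBal F.L γ b₀ p₀ j) U → ∀ (b b' : PBond _ _) (v v' : Fin 3 → ℝ), ‖v‖ ≤ 1 → ‖v'‖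 ≤ 1 → ∃ g : ℂ × ℂ → ℂ, DifferentiableOn ℂ g (Metric.ball (0 : ℂ) (rA * (49 / 50 * θBal F.L γ b₀ p₀ j)) ×ˢ Metric.ball (0 : ℂ) (rA * (49 / 50 * θBal F.L γ b₀ p₀ j))) ∧ (∀ (s t : ℝ) (V Z : GaugeField _ _ ↥(Matrix.specialUnitaryGroup (Fin 2) ℂ)), |s| < rA * (49 / 50 * θBal F.L γ b₀ p₀ j) → |t| < rA * (49 / 50 * θBal F.L γ b₀ p₀ j) → (∀ e, e ≠ b → V e = U e) → V b = U b * expPt (s • v) → (∀ e, e ≠ b' → Z e = V e) → Z b' = V b' * expPt (t • v') → g ((s : ℂ), (t : ℂ)) = (((Real.log (ρ' j Z)) : ℝ) : ℂ)) ∧ ∀ z ∈ Metric.ball (0 : ℂ) (rA * (49 / 50 * θBal F.L γ b₀ p₀ j)) ×ˢ Metric.ball (0 : ℂ) (rA * (49 / 50 * θBal F.L γ b₀ p₀ j)), ‖g z - g 0‖ ≤ (Bρ j))))) → ∀ (w : ℝ), 0 ≤ w → w / (((F.L : ℝ) ^ Ts / γ) * θBal F.L γ b₀ p₀ Ts ^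 2) ≤ w₀ → (∃ k : PBond (F.P Ts) 0 → PBond (F.P Ts) 0 → ℝ, (∀ b b', 0 ≤ k b b') ∧ (∀ b, ∑ b', k b b' * Real.exp (κ * (b.src.tdist b'.src : ℝ)) ≤ w) ∧ (∀ (b b' : PBond _ _) (v v' : Fin 3 → ℝ) (U V W Z : GaugeField _ _ ↥(Matrix.specialUnitaryGroup (Fin 2) ℂ)), ‖v‖ ≤ (rA / 2) * (θBal F.L γ b₀ p₀ Ts / 4) → ‖v'‖ ≤ (rA / 2) * (θBal F.L γ b₀ p₀ Ts / 4) → PlaqSmall (θBal F.L γ b₀ p₀ Ts / 4) U → PlaqSmall (θBal F.L γ b₀ p₀ Ts / 4) V → PlaqSmall (θBal F.L γ b₀ p₀ Ts / 4) W → PlaqSmall (θBal F.L γ b₀ p₀ Ts / 4) Z → (∀ e, e ≠ b → V e = U e) → V b = U b * expPt v → (∀ e, e ≠ b' → W e = U e) → W b' = U b' * expPt v' → (∀ e, e ≠ b' → Z e = V e) → Z b' = V b' * expPt v' → |(Real.log (ρ Ts Z) - Real.log (ρ' Ts Z)) - (Real.log (ρ Ts V) - Real.log (ρ' Ts V)) -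 (Real.log (ρ Ts W) - Real.log (ρ' Ts W)) + (Real.log (ρ Ts U) - Real.log (ρ' Ts U))| ≤ k b b' * (‖v‖ / (θBal F.L γ b₀ p₀ Ts / 4)) * (‖v'‖ / (θBal F.L γ b₀ p₀ Ts / 4)))) → ∀ (j : ℕ), j₁ ≤ j → ∀ (hjTs : j + 1 ≤ Ts), ∀ (σ : ProbabilityTheory.Kernel (GaugeField (F.P j) 0 ↥(Matrix.specialUnitaryGroup (Fin 2) ℂ)) (GaugeField (F.P Ts) 0 ↥(Matrix.specialUnitaryGroup (Fin 2) ℂ))), ProbabilityTheory.IsMarkovKernel σ → (Measure.map (descendTo F ℰp j Ts (Nat.le_of_succ_le hjTs)) (fieldMeasure (F.P Ts) 0 ↥(Matrix.specialUnitaryGroup (Fin 2) ℂ))).bind ⇑σ = fieldMeasure (F.P Ts) 0 ↥(Matrix.specialUnitaryGroup (Fin 2) ℂ) → (∀ᵐ V ∂(Measure.map (descendTo F ℰp j Ts (Nat.le_of_succ_le hjTs)) (fieldMeasure (F.P Ts) 0 ↥(Matrix.specialUnitaryGroup (Fin 2) ℂ))), ∀ᵐ U ∂(σ V), descendTo F ℰp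 j Ts (Nat.le_of_succ_le hjTs) U = V) → ∀ (mfun : GaugeField (F.P j) 0 ↥(Matrix.specialUnitaryGroup (Fin 2) ℂ) → ℝ), ContinuousOn mfun {V | PlaqSmall (θBal F.L γ b₀ p₀ j) V} → (∀ᵐ V ∂(fieldMeasure (F.P j) 0 ↥(Matrix.specialUnitaryGroup (Fin 2) ℂ)), PlaqSmall (θBal F.L γ b₀ p₀ j) V → MeasureTheory.Integrable (fun U => (∏ i ∈ Finset.range (Ts - j), (if h : j + 1 + i ≤ Ts then (∏ p : Plaq (F.P (j + 1 + i)) 0, max 0 (min 1 ((24 / 25 * θBal F.L γ b₀ p₀ (j + 1 + i) - dist1 (GaugeField.plaqHol (descendTo F ℰp (j + 1 + i) Ts h U) p)) / ((24 / 25 - 1 / 2) * θBal F.L γ b₀ p₀ (j + 1 + i))))) else 1)) * (Real.log (ρ Ts U) - Real.log (ρ' Ts U)) * ρ' Ts U) (σ V) ∧ mfun V = (∫ U, (∏ i ∈ Finset.range (Ts - j), (if h : j + 1 + i ≤ Ts then (∏ p : Plaq (F.P (j + 1 + i)) 0, max 0 (min 1 ((24 / 25 * θBal F.L γ b₀ p₀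 (j + 1 + i) - dist1 (GaugeField.plaqHol (descendTo F ℰp (j + 1 + i) Ts h U) p)) / ((24 / 25 - 1 / 2) * θBal F.L γ b₀ p₀ (j + 1 + i))))) else 1)) * (Real.log (ρ Ts U) - Real.log (ρ' Ts U)) * ρ' Ts U ∂(σ V)) / (∫ U, (∏ i ∈ Finset.range (Ts - j), (if h : j + 1 + i ≤ Ts then (∏ p : Plaq (F.P (j + 1 + i)) 0, max 0 (min 1 ((24 / 25 * θBal F.L γ b₀ p₀ (j + 1 + i) - dist1 (GaugeField.plaqHol (descendTo F ℰp (j + 1 + i) Ts h U) p)) / ((24 / 25 - 1 / 2) * θBal F.L γ b₀ p₀ (j + 1 + i))))) else 1)) * ρ' Ts U ∂(σ V))) → ∃ (c' : Plaq (F.P j) 0 → ℝ) (a' w' : ℝ), 0 ≤ a' ∧ 0 ≤ w' ∧ a' + θ * (w' / (((F.L : ℝ) ^ j / γ) * θBal F.L γ b₀ p₀ j ^ 2)) ≤ C * (w / (((F.L : ℝ) ^ Ts / γ) * θBal F.L γ b₀ p₀ Ts ^ 2)) * (w / (((F.L : ℝ) ^ Ts / γ) * θBal F.L γ b₀ p₀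 Ts ^ 2)) + δ j ∧ (∀ p, |c' p| ≤ a') ∧ ∃ k' : PBond (F.P j) 0 → PBond (F.P j) 0 → ℝ, (∀ b b', 0 ≤ k' b b') ∧ (∀ b, ∑ b', k' b b' * Real.exp (κ * (b.src.tdist b'.src : ℝ)) ≤ w') ∧ (∀ (b b' : PBond _ _) (v v' : Fin 3 → ℝ) (U V W Z : GaugeField _ _ ↥(Matrix.specialUnitaryGroup (Fin 2) ℂ)), ‖v‖ ≤ r * (θBal F.L γ b₀ p₀ j / 4) → ‖v'‖ ≤ r * (θBal F.L γ b₀ p₀ j / 4) → PlaqSmall (θBal F.L γ b₀ p₀ j / 4) U → PlaqSmall (θBal F.L γ b₀ p₀ j / 4) V → PlaqSmall (θBal F.L γ b₀ p₀ j / 4) W → PlaqSmall (θBal F.L γ b₀ p₀ j / 4) Z → (∀ e, e ≠ b → V e = U e) → V b = U b * expPt v → (∀ e, e ≠ b' → W e = U e) → W b' = U b' * expPt v' → (∀ e, e ≠ b' → Z e = V e) → Z b' = V b' * expPt v' → |(Real.log (ρ j Z) - Real.log (ρ' j Z) - mfun Z - ((F.L : ℝ) ^ j / γ) * ∑ p,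 c' p * (1 - reTr (GaugeField.plaqHol Z p))) - (Real.log (ρ j V) - Real.log (ρ' j V) - mfun V - ((F.L : ℝ) ^ j / γ) * ∑ p, c' p * (1 - reTr (GaugeField.plaqHol V p))) - (Real.log (ρ j W) - Real.log (ρ' j W) - mfun W - ((F.L : ℝ) ^ j / γ) * ∑ p, c' p * (1 - reTr (GaugeField.plaqHol W p))) + (Real.log (ρ j U) - Real.log (ρ' j U) - mfun U - ((F.L : ℝ) ^ j / γ) * ∑ p, c' p * (1 - reTr (GaugeField.plaqHol U p)))| ≤ k' b b' * (‖v‖ / (θBal F.L γ b₀ p₀ j / 4)) * (‖v'‖ / (θBal F.L γ b₀ p₀ j / 4)))) :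
    ∃ pW : ℝ, ∃ γ₁ : ℝ, 0 < γ₁ ∧ ∀ (F : T3Family) (γ : ℝ), 0 < γ → γ ≤ γ₁ → ∀ (b₀ p₀ : ℝ) (j₀ : ℕ) (prm : ℕ → ClassParams) (η : ℕ → ℝ) (rA : ℝ) (Bρ : ℕ → ℝ), 0 < b₀ → 0 < p₀ → pW ≤ p₀ → AdmissibleClassParams F γ b₀ p₀ prm → (∀ j, 0 ≤ η j) → Summable η → Summable (fun i => ∑' k, η (k + i)) → Tendsto (fun j => (∑' k, η (k + j)) * ((1 + 2 * ((F.L : ℝ) ^ j / γ) * (Fintype.card (Plaq (F.P j) 0) : ℝ)) * (Fintype.card (PBond (F.P j) 0) : ℝ) ^ 2)) atTop (𝓝 0) → 0 < rA → ∃ κ₀ : ℝ, 0 < κ₀ ∧ ∀ (κ : ℝ), 0 < κ → κ ≤ κ₀ → ∃ (θ r Ctr C w₀ : ℝ) (εd δ : ℕ → ℝ) (j₁ : ℕ), 0 < θ ∧ 0 < r ∧ 1 ≤ Ctr ∧ 0 ≤ C ∧ 0 < w₀ ∧ (∀ j, 0 ≤ εd j ∧ 0 ≤ δ j) ∧ Summable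 εd ∧ Summable δ ∧ Summable (fun i => ∑' k, δ (k + i)) ∧ Tendsto (fun j => (∑' k, δ (k + j)) * ((1 + 2 * ((F.L : ℝ) ^ j / γ) * (Fintype.card (Plaq (F.P j) 0) : ℝ)) * (Fintype.card (PBond (F.P j) 0) : ℝ) ^ 2)) atTop (𝓝 0) ∧ j₀ ≤ j₁ ∧ ∀ (ν : ℕ → (j : ℕ) → MeasureTheory.Measure (GaugeField (F.P j) 0 ↥(Matrix.specialUnitaryGroup (Fin 2) ℂ))), (∀ K, ν K K = T4GenFunBounds.gibbsMeasure (F.P K) ((F.scheme ℰp γ).β K)) → (∀ K j, j < K → ν K j = Measure.map (descend F ℰp j) (ν K (j + 1))) → ∀ (K K' : ℕ), K ≤ K' → ∀ (Ts T : ℕ), Ts < T → T ≤ K → ∀ (μ μ' : ((j : ℕ) → MeasureTheory.Measure (GaugeField (F.P j) 0 ↥(Matrix.specialUnitaryGroup (Fin 2) ℂ)))) (ρ ρ' : ((j : ℕ) → GaugeField (F.P j) 0 ↥(Matrix.specialUnitaryGroup (Fin 2) ℂ) → ℝ)), (∀ j : ℕ, Ts ≤ j → j ≤ T → μ j = ν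 K j ∧ μ' j = ν K' j) → (∀ j : ℕ, j < Ts → μ j = Measure.map (descend F ℰp j) ((μ (j + 1)).withDensity (fun U => ENNReal.ofReal ((∏ p : Plaq _ _, max 0 (min 1 ((24 / 25 * (θBal F.L γ b₀ p₀ (j + 1)) - dist1 (GaugeField.plaqHol U p)) / ((24 / 25 - 1 / 2) * (θBal F.L γ b₀ p₀ (j + 1))))))))) ∧ μ' j = Measure.map (descend F ℰp j) ((μ' (j + 1)).withDensity (fun U => ENNReal.ofReal ((∏ p : Plaq _ _, max 0 (min 1 ((24 / 25 * (θBal F.L γ b₀ p₀ (j + 1)) - dist1 (GaugeField.plaqHol U p)) / ((24 / 25 - 1 / 2) * (θBal F.L γ b₀ p₀ (j + 1)))))))))) → (∀ j : ℕ, Ts ≤ j → j < T → μ j = Measure.map (descend F ℰp j) (μ (j + 1)) ∧ μ' j = Measure.map (descend F ℰp j) (μ' (j + 1))) → (∀ j : ℕ, j ≤ T → IsFiniteMeasure (μ j) ∧ IsFiniteMeasure (μ' j)) → (∀ j : ℕ, j₀ ≤ j → j ≤ T → ((∀ U, PlaqSmall (θBal F.L γ b₀ p₀ j) U → 0 < ρ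 j U ∧ 0 < ρ' j U) ∧ μ j = (fieldMeasure _ _ _).withDensity (fun U => ENNReal.ofReal (ρ j U)) ∧ μ' j = (fieldMeasure _ _ _).withDensity (fun U => ENNReal.ofReal (ρ' j U)) ∧ (∃ (K : ℕ) (hjK : j ≤ K),
        ∃ κ : ℝ, ∃ (bg : GaugeField (F.P K) (K - j) (Matrix.specialUnitaryGroup (Fin 2) ℂ) → GaugeField (F.P K) 0 (Matrix.specialUnitaryGroup (Fin 2) ℂ))
          (nDom : ℕ) (supp : Fin nDom → Set (PBond (F.P K) 0)) (foot : Fin nDom → Finset (Site (F.P K) (K - j)))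
          (len : Fin nDom → ℝ) (wt : Fin nDom → ℝ) (act : Fin nDom → GaugeField (F.P K) 0 (Matrix.specialUnitaryGroup (Fin 2) ℂ) → ℝ)
          (cst : ℝ) (lf : GaugeField (F.P K) (K - j) (Matrix.specialUnitaryGroup (Fin 2) ℂ) → ℝ),
          (∀ V, 0 ≤ readAtLevel F hjK (fun U => Real.exp κ * ρ j U) V) ∧
          Measurable (readAtLevel F hjK (fun U => Real.exp κ * ρ j U)) ∧
          GaugeField.GaugeInvariant (readAtLevel F hjK (fun U => Real.exp κ * ρ j U)) ∧
          (∀ V, PlaqSmall (prm j).δ V →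
            IsBackground (fun i => BlockAveraging.blockAvg (P := F.P K) (j := i) ℰp) {U | PlaqSmall (prm j).δreg U} (K - j) V (bg V)) ∧
          (∀ X, (foot X).Nonempty) ∧ (∀ X b, b ∈ supp X → iterBlockOf (K - j) b.src ∈ foot X) ∧ (∀ X, 0 ≤ len X) ∧ (∀ X, 0 ≤ wt X) ∧
          (∀ X, ∀ y ∈ foot X, ∀ y' ∈ foot X, (Site.tdist y y' : ℝ) ≤ (prm j).M * (len X + 1)) ∧
          (∀ X (U U' : GaugeField (F.P K) 0 (Matrix.specialUnitaryGroup (Fin 2) ℂ)), (∀ b ∈ supp X, U b = U' b) → act X U = act X U') ∧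
          (∀ X, GaugeField.GaugeInvariant (act X)) ∧
          (∀ X V, PlaqSmall (prm j).δ V → PlaqSmall ((prm j).δ * ((F.L : ℝ)⁻¹) ^ (2 * (K - j))) (bg V) →
            |act X (bg V)| ≤ wt X * Real.exp (-((prm j).κ * len X))) ∧
          (∀ y : Site (F.P K) (K - j), ∑ X ∈ Finset.univ.filter (fun X => y ∈ foot X), wt X * Real.exp (-((prm j).κ * len X)) ≤ (prm j).Ccov) ∧
          |cst| ≤ (prm j).cE * Fintype.card (Site (F.P K) (K - j)) ∧
          (∀ V, PlaqSmall (prm j).δ V → PlaqSmall ((prm j).δ * ((F.L : ℝ)⁻¹) ^ (2 * (K - j))) (bg V) →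
            Real.exp (-((prm j).β * wilsonAction4 (bg V)) + (∑ X, act X (bg V)) + cst - (prm j).slack) ≤ readAtLevel F hjK (fun U => Real.exp κ * ρ j U) V) ∧
          (∀ V, PlaqSmall (prm j).δ V → PlaqSmall ((prm j).δ * ((F.L : ℝ)⁻¹) ^ (2 * (K - j))) (bg V) →
            readAtLevel F hjK (fun U => Real.exp κ * ρ j U) V ≤ Real.exp (-((prm j).β * wilsonAction4 (bg V)) + (∑ X, act X (bg V)) + cst + (prm j).slack) + lf V) ∧
          (∀ V, 0 ≤ lf V) ∧ (∀ V, lf V ≤ Real.exp (-(prm j).cLF) * Real.exp ((prm j).c5 * Fintype.card (Site (F.P K) (K - j)))) ∧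
          (∀ V (S : Finset (Plaq (F.P K) (K - j))), (∀ p ∈ S, (prm j).δL ≤ dist1 (GaugeField.plaqHol V p)) →
            readAtLevel F hjK (fun U => Real.exp κ * ρ j U) V ≤ Real.exp (-((prm j).cLF * S.card)) * Real.exp ((prm j).c5 * Fintype.card (Site (F.P K) (K - j))))) ∧ (∃ (K : ℕ) (hjK : j ≤ K),
        ∃ κ : ℝ, ∃ (bg : GaugeField (F.P K) (K - j) (Matrix.specialUnitaryGroup (Fin 2) ℂ) → GaugeField (F.P K) 0 (Matrix.specialUnitaryGroup (Fin 2) ℂ))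
          (nDom : ℕ) (supp : Fin nDom → Set (PBond (F.P K) 0)) (foot : Fin nDom → Finset (Site (F.P K) (K - j)))
          (len : Fin nDom → ℝ) (wt : Fin nDom → ℝ) (act : Fin nDom → GaugeField (F.P K) 0 (Matrix.specialUnitaryGroup (Fin 2) ℂ) → ℝ)
          (cst : ℝ) (lf : GaugeField (F.P K) (K - j) (Matrix.specialUnitaryGroup (Fin 2) ℂ) → ℝ),
          (∀ V, 0 ≤ readAtLevel F hjK (fun U => Real.exp κ * ρ' j U) V) ∧
          Measurable (readAtLevel F hjK (fun U => Real.exp κ * ρ' j U)) ∧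
          GaugeField.GaugeInvariant (readAtLevel F hjK (fun U => Real.exp κ * ρ' j U)) ∧
          (∀ V, PlaqSmall (prm j).δ V →
            IsBackground (fun i => BlockAveraging.blockAvg (P := F.P K) (j := i) ℰp) {U | PlaqSmall (prm j).δreg U} (K - j) V (bg V)) ∧
          (∀ X, (foot X).Nonempty) ∧ (∀ X b, b ∈ supp X → iterBlockOf (K - j) b.src ∈ foot X) ∧ (∀ X, 0 ≤ len X) ∧ (∀ X, 0 ≤ wt X) ∧
          (∀ X, ∀ y ∈ foot X, ∀ y' ∈ foot X, (Site.tdist y y' : ℝ) ≤ (prm j).M * (len X + 1)) ∧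
          (∀ X (U U' : GaugeField (F.P K) 0 (Matrix.specialUnitaryGroup (Fin 2) ℂ)), (∀ b ∈ supp X, U b = U' b) → act X U = act X U') ∧
          (∀ X, GaugeField.GaugeInvariant (act X)) ∧
          (∀ X V, PlaqSmall (prm j).δ V → PlaqSmall ((prm j).δ * ((F.L : ℝ)⁻¹) ^ (2 * (K - j))) (bg V) →
            |act X (bg V)| ≤ wt X * Real.exp (-((prm j).κ * len X))) ∧
          (∀ y : Site (F.P K) (K - j), ∑ X ∈ Finset.univ.filter (fun X => y ∈ foot X), wt X * Real.exp (-((prm j).κ * len X)) ≤ (prm j).Ccov) ∧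
          |cst| ≤ (prm j).cE * Fintype.card (Site (F.P K) (K - j)) ∧
          (∀ V, PlaqSmall (prm j).δ V → PlaqSmall ((prm j).δ * ((F.L : ℝ)⁻¹) ^ (2 * (K - j))) (bg V) →
            Real.exp (-((prm j).β * wilsonAction4 (bg V)) + (∑ X, act X (bg V)) + cst - (prm j).slack) ≤ readAtLevel F hjK (fun U => Real.exp κ * ρ' j U) V) ∧
          (∀ V, PlaqSmall (prm j).δ V → PlaqSmall ((prm j).δ * ((F.L : ℝ)⁻¹) ^ (2 * (K - j))) (bg V) →
            readAtLevel F hjK (fun U => Real.exp κ * ρ' j U) V ≤ Real.exp (-((prm j).β * wilsonAction4 (bg V)) + (∑ X, act X (bg V)) + cst + (prm j).slack) + lf V) ∧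
          (∀ V, 0 ≤ lf V) ∧ (∀ V, lf V ≤ Real.exp (-(prm j).cLF) * Real.exp ((prm j).c5 * Fintype.card (Site (F.P K) (K - j)))) ∧
          (∀ V (S : Finset (Plaq (F.P K) (K - j))), (∀ p ∈ S, (prm j).δL ≤ dist1 (GaugeField.plaqHol V p)) →
            readAtLevel F hjK (fun U => Real.exp κ * ρ' j U) V ≤ Real.exp (-((prm j).cLF * S.card)) * Real.exp ((prm j).c5 * Fintype.card (Site (F.P K) (K - j))))) ∧ μ j {U | ¬ PlaqSmall (θBal F.L γ b₀ p₀ j) U} ≤ ENNReal.ofReal (η j) ∧ μ' j {U | ¬ PlaqSmall (θBal F.L γ b₀ p₀ j) U} ≤ ENNReal.ofReal (η j) ∧ (ContinuousOn (ρ j) {U | PlaqSmall (θBal F.L γ b₀ p₀ j) U} ∧ ContinuousOn (ρ' j) {U | PlaqSmall (θBal F.L γ b₀ p₀ j) U}) ∧ ((∀ (U : GaugeField _ _ ↥(Matrix.specialUnitaryGroup (Fin 2) ℂ)), PlaqSmall (49 / 50 * θBal F.L γ b₀ p₀ j) U → ∀ (b b' : PBond _ _) (v v' : Fin 3 → ℝ),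 ‖v‖ ≤ 1 → ‖v'‖ ≤ 1 → ∃ g : ℂ × ℂ → ℂ, DifferentiableOn ℂ g (Metric.ball (0 : ℂ) (rA * (49 / 50 * θBal F.L γ b₀ p₀ j)) ×ˢ Metric.ball (0 : ℂ) (rA * (49 / 50 * θBal F.L γ b₀ p₀ j))) ∧ (∀ (s t : ℝ) (V Z : GaugeField _ _ ↥(Matrix.specialUnitaryGroup (Fin 2) ℂ)), |s| < rA * (49 / 50 * θBal F.L γ b₀ p₀ j) → |t| < rA * (49 / 50 * θBal F.L γ b₀ p₀ j) → (∀ e, e ≠ b → V e = U e) → V b = U b * expPt (s • v) → (∀ e, e ≠ b' → Z e = V e) → Z b' = V b' * expPt (t • v') → g ((s : ℂ), (t : ℂ)) = (((Real.log (ρ j Z)) : ℝ) : ℂ)) ∧ ∀ z ∈ Metric.ball (0 : ℂ) (rA * (49 / 50 * θBal F.L γ b₀ p₀ j)) ×ˢ Metric.ball (0 : ℂ) (rA * (49 / 50 * θBal F.L γ b₀ p₀ j)), ‖g z - g 0‖ ≤ (Bρ j)) ∧ (∀ (U : GaugeField _ _ ↥(Matrix.specialUnitaryGroup (Fin 2)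 ℂ)), PlaqSmall (49 / 50 * θBal F.L γ b₀ p₀ j) U → ∀ (b b' : PBond _ _) (v v' : Fin 3 → ℝ), ‖v‖ ≤ 1 → ‖v'‖ ≤ 1 → ∃ g : ℂ × ℂ → ℂ, DifferentiableOn ℂ g (Metric.ball (0 : ℂ) (rA * (49 / 50 * θBal F.L γ b₀ p₀ j)) ×ˢ Metric.ball (0 : ℂ) (rA * (49 / 50 * θBal F.L γ b₀ p₀ j))) ∧ (∀ (s t : ℝ) (V Z : GaugeField _ _ ↥(Matrix.specialUnitaryGroup (Fin 2) ℂ)), |s| < rA * (49 / 50 * θBal F.L γ b₀ p₀ j) → |t| < rA * (49 / 50 * θBal F.L γ b₀ p₀ j) → (∀ e, e ≠ b → V e = U e) → V b = U b * expPt (s • v) → (∀ e, e ≠ b' → Z e = V e) → Z b' = V b' * expPt (t • v') → g ((s : ℂ), (t : ℂ)) = (((Real.log (ρ' j Z)) : ℝ) : ℂ)) ∧ ∀ z ∈ Metric.ball (0 : ℂ) (rA * (49 / 50 * θBal F.L γ b₀ p₀ j)) ×ˢ Metric.ball (0 : ℂ) (rA * (49 / 50 * θBal F.L γ b₀ p₀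 j)), ‖g z - g 0‖ ≤ (Bρ j))))) → ∀ (w : ℝ), 0 ≤ w → w / (((F.L : ℝ) ^ Ts / γ) * θBal F.L γ b₀ p₀ Ts ^ 2) ≤ w₀ → (∃ k : PBond (F.P Ts) 0 → PBond (F.P Ts) 0 → ℝ, (∀ b b', 0 ≤ k b b') ∧ (∀ b, ∑ b', k b b' * Real.exp (κ * (b.src.tdist b'.src : ℝ)) ≤ w) ∧ (∀ (b b' : PBond _ _) (v v' : Fin 3 → ℝ) (U V W Z : GaugeField _ _ ↥(Matrix.specialUnitaryGroup (Fin 2) ℂ)), ‖v‖ ≤ (rA / 2) * (θBal F.L γ b₀ p₀ Ts / 4) → ‖v'‖ ≤ (rA / 2) * (θBal F.L γ b₀ p₀ Ts / 4) → PlaqSmall (θBal F.L γ b₀ p₀ Ts / 4) U → PlaqSmall (θBal F.L γ b₀ p₀ Ts / 4) V → PlaqSmall (θBal F.L γ b₀ p₀ Ts / 4) W → PlaqSmall (θBal F.L γ b₀ p₀ Ts / 4) Z → (∀ e, e ≠ b → V e = U e) → V b = U b * expPt v → (∀ e, e ≠ b' → W e = U e) → W b' = U b' * expPt v' → (∀ e,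 e ≠ b' → Z e = V e) → Z b' = V b' * expPt v' → |(Real.log (ρ Ts Z) - Real.log (ρ' Ts Z)) - (Real.log (ρ Ts V) - Real.log (ρ' Ts V)) - (Real.log (ρ Ts W) - Real.log (ρ' Ts W)) + (Real.log (ρ Ts U) - Real.log (ρ' Ts U))| ≤ k b b' * (‖v‖ / (θBal F.L γ b₀ p₀ Ts / 4)) * (‖v'‖ / (θBal F.L γ b₀ p₀ Ts / 4)))) → ∀ (j : ℕ), j₁ ≤ j → j + 1 ≤ Ts → ∃ (c' : Plaq (F.P j) 0 → ℝ) (a' w' : ℝ), 0 ≤ a' ∧ 0 ≤ w' ∧ a' + θ * (w' / (((F.L : ℝ) ^ j / γ) * θBal F.L γ b₀ p₀ j ^ 2)) ≤ (Ctr + εd (T - (Ts + 1)) + C * (w / (((F.L : ℝ) ^ Ts / γ) * θBal F.L γ b₀ p₀ Ts ^ 2))) * (w / (((F.L : ℝ) ^ Ts / γ) * θBal F.L γ b₀ p₀ Ts ^ 2)) + δ j ∧ (∀ p, |c' p| ≤ a') ∧ ∃ k' : PBond (F.P j) 0 → PBond (F.P j) 0 → ℝ, (∀ b b', 0 ≤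 k' b b') ∧ (∀ b, ∑ b', k' b b' * Real.exp (κ * (b.src.tdist b'.src : ℝ)) ≤ w') ∧ (∀ (b b' : PBond _ _) (v v' : Fin 3 → ℝ) (U V W Z : GaugeField _ _ ↥(Matrix.specialUnitaryGroup (Fin 2) ℂ)), ‖v‖ ≤ r * (θBal F.L γ b₀ p₀ j / 4) → ‖v'‖ ≤ r * (θBal F.L γ b₀ p₀ j / 4) → PlaqSmall (θBal F.L γ b₀ p₀ j / 4) U → PlaqSmall (θBal F.L γ b₀ p₀ j / 4) V → PlaqSmall (θBal F.L γ b₀ p₀ j / 4) W → PlaqSmall (θBal F.L γ b₀ p₀ j / 4) Z → (∀ e, e ≠ b → V e = U e) → V b = U b * expPt v → (∀ e, e ≠ b' → W e = U e) → W b' = U b' * expPt v' → (∀ e, e ≠ b' → Z e = V e) → Z b' = V b' * expPt v' → |(Real.log (ρ j Z) - Real.log (ρ' j Z) - ((F.L : ℝ) ^ j / γ) * ∑ p, c' p * (1 - reTr (GaugeField.plaqHol Z p))) - (Real.log (ρ j V) - Real.log (ρ' j V) - ((F.L : ℝ) ^ j / γ) * ∑ p, c' p * (1 - reTr (GaugeField.plaqHol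 V p))) - (Real.log (ρ j W) - Real.log (ρ' j W) - ((F.L : ℝ) ^ j / γ) * ∑ p, c' p * (1 - reTr (GaugeField.plaqHol W p))) + (Real.log (ρ j U) - Real.log (ρ' j U) - ((F.L : ℝ) ^ j / γ) * ∑ p, c' p * (1 - reTr (GaugeField.plaqHol U p)))| ≤ k' b b' * (‖v‖ / (θBal F.L γ b₀ p₀ j / 4)) * (‖v'‖ / (θBal F.L γ b₀ p₀ j / 4))) := by
  classical
  obtain ⟨pWL, γL, hγL, hL⟩ := hL
  obtain ⟨pWJ, γJ, hγJ, hJ⟩ := hJ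
  refine ⟨max pWL pWJ, min (min γL γJ) 1, lt_min (lt_min hγL hγJ) one_pos, ?_⟩
  intro F γ hγ hγ1 b₀ p₀ j₀ prm η rA Bρ hb₀ hp₀ hpW hadm hη0 hηs hηss hηt hrA
  have hpWL : pWL ≤ p₀ := (le_max_left _ _).trans hpW
  have hpWJ : pWJ ≤ p₀ := (le_max_right _ _).trans hpW
  have hγone : γ ≤ 1 := hγ1.trans (min_le_right _ _)
  have hγL' : γ ≤ γL := hγ1.trans ((min_le_left _ _).trans (min_le_left _ _))
  have hγJ' : γ ≤ γJ := hγ1.trans ((min_le_left _ _).trans (min_le_right _ _))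
  -- (L20): the m-step fibre-mean version from a height `jA`
  obtain ⟨jA, hA⟩ := exists_height_fibreMeanVersionMW_of_towerCut F γ b₀ p₀ hγ hγone hb₀ hp₀
  obtain ⟨κL, hκL, hL⟩ := hL F γ hγ hγL' b₀ p₀ j₀ prm η rA Bρ hb₀ hp₀ hpWL hadm hη0 hηs hηss hηt hrA
  obtain ⟨κJ, hκJ, hJ⟩ := hJ F γ hγ hγJ' b₀ p₀ j₀ prm η rA Bρ hb₀ hp₀ hpWJ hadm hη0 hηs hηss hηt hrA
  refine ⟨min κL κJ, lt_min hκL hκJ, ?_⟩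
  intro κ hκ hκle
  obtain ⟨θL, rL, Ctr, wL, εd, δL, jL, hθL, hrL, hCtr, hwL, hnnL, hεds, hδLs, hδLss, hδLt, hjL, hL⟩ :=
    hL κ hκ (hκle.trans (min_le_left _ _))
  obtain ⟨θJ, rJ, C, wJ, δJ, jJ, hθJ, hrJ, hC, hwJ, hnnJ, hδJs, hδJss, hδJt, hjJ, hJ⟩ :=
    hJ κ hκ (hκle.trans (min_le_right _ _))
  have h1 : ∀ i, Summable (fun k => δL (k + i)) := fun i => (summable_nat_add_iff i).mpr hδLs
  have h2 : ∀ i, Summable (fun k => δJ (k + i)) := fun i => (summable_nat_add_iff i).mpr hδJs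
  refine ⟨min θL θJ, min rL rJ, Ctr, C, min wL wJ, εd, fun j => δL j + δJ j, max (max jL jJ) jA,
    lt_min hθL hθJ, lt_min hrL hrJ, hCtr, hC, lt_min hwL hwJ, ?_, hεds, hδLs.add hδJs, ?_, ?_,
    hjL.trans ((le_max_left jL jJ).trans (le_max_left (max jL jJ) jA)), ?_⟩
  · intro j
    exact ⟨(hnnL j).1, add_nonneg (hnnL j).2 (hnnJ j)⟩
  · have key : (fun i => ∑' k, (δL (k + i) + δJ (k + i))) =
        fun i => (∑' k, δL (k + i)) + ∑' k, δJ (k + i) := by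
      funext i
      exact (h1 i).tsum_add (h2 i)
    rw [key]
    exact hδLss.add hδJss
  · have key : (fun j => (∑' k, (δL (k + j) + δJ (k + j))) * ((1 + 2 * ((F.L : ℝ) ^ j / γ) * (Fintype.card (Plaq (F.P j) 0) : ℝ)) * (Fintype.card (PBond (F.P j) 0) : ℝ) ^ 2)) =
        fun j => (∑' k, δL (k + j)) * ((1 + 2 * ((F.L : ℝ) ^ j / γ) * (Fintype.card (Plaq (F.P j) 0) : ℝ)) * (Fintype.card (PBond (F.P j) 0) : ℝ) ^ 2) +
          (∑' k, δJ (k + j)) * ((1 + 2 * ((F.L : ℝ) ^ j / γ) * (Fintype.card (Plaq (F.P j) 0) : ℝ)) * (Fintype.card (PBond (F.P j) 0) : ℝ) ^ 2) := by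
      funext j
      rw [(h1 j).tsum_add (h2 j), add_mul]
    rw [key]
    simpa using hδLt.add hδJt
  · intro ν hG hCν K K' hKK' Ts T hTs hTK μ μ' ρ ρ' hanch hcut hcons hfin hwin w hw0 hwle hseed j hj hjTs
    have hjLJ : max jL jJ ≤ j := (le_max_left (max jL jJ) jA).trans hj
    have hjA : jA ≤ j := (le_max_right (max jL jJ) jA).trans hj
    have hjLj : jL ≤ j := (le_max_left jL jJ).trans hjLJ
    have hjJj : jJ ≤ j := (le_max_right jL jJ).trans hjLJ
    have hj₀ : j₀ ≤ j := hjL.trans hjLj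
    -- the disintegration `σ` of product Haar along `descendTo j Ts` (✓(L16))
    obtain ⟨σ, hσM, hσb, hσf⟩ := exists_descentDisintegration_descendTo F j Ts (Nat.le_of_succ_le hjTs)
    -- a measurable tower agreeing with `ρ` on `[j₀, T]` (R-n4 un-scaling; constant off the block)
    obtain ⟨ρt, hρt_eq, hρt_meas⟩ : ∃ ρt : (n : ℕ) → GaugeField (F.P n) 0 ↥(Matrix.specialUnitaryGroup (Fin 2) ℂ) → ℝ,
        (∀ n, j₀ ≤ n → n ≤ T → ρt n = ρ n) ∧ (∀ n, Measurable (ρt n)) := by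
      refine ⟨fun n => if j₀ ≤ n ∧ n ≤ T then ρ n else fun _ => 1,
        fun n hn1 hn2 => by dsimp only; rw [if_pos ⟨hn1, hn2⟩], fun n => ?_⟩
      dsimp only
      by_cases hn : j₀ ≤ n ∧ n ≤ T
      · rw [if_pos hn]
        obtain ⟨K, hjK, κ', _bg, _nDom, _supp, _foot, _len, _wt, _act, _cst, _lf, _h0, hκ', _⟩ := (hwin n hn.1 hn.2).2.2.2.1
        have hm1 : Measurable (fun U => Real.exp κ' * ρ n U) := measurable_of_readAtLevel F hjK hκ'
        have hm2 : ρ n = fun U => (Real.exp κ')⁻¹ * (Real.exp κ' * ρ n U) := by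
          funext U; rw [← mul_assoc, inv_mul_cancel₀ (Real.exp_pos κ').ne', one_mul]
        rw [hm2]; exact hm1.const_mul _
      · rw [if_neg hn]; exact measurable_const
    -- clause ⑦ on `[j, Ts)` in `dU·ρ` form (blocks ⑦ + ⑧)
    have h7t : ∀ n, j ≤ n → n < Ts →
        (fieldMeasure (F.P n) 0 ↥(Matrix.specialUnitaryGroup (Fin 2) ℂ)).withDensity (fun V => ENNReal.ofReal (ρt n V)) =
          Measure.map (descend F ℰp n)
            (((fieldMeasure (F.P (n + 1)) 0 ↥(Matrix.specialUnitaryGroup (Fin 2) ℂ)).withDensity (fun U => ENNReal.ofReal (ρt (n + 1) U))).withDensity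
              (fun U => ENNReal.ofReal (∏ p : Plaq (F.P (n + 1)) 0,
                max 0 (min 1 ((24 / 25 * θBal F.L γ b₀ p₀ (n + 1) - dist1 (GaugeField.plaqHol U p)) / ((24 / 25 - 1 / 2) * θBal F.L γ b₀ p₀ (n + 1))))))) := by
      intro n hjn hnTs
      have e1 : ρt n = ρ n := hρt_eq n (by omega) (by omega)
      have e2 : ρt (n + 1) = ρ (n + 1) := hρt_eq (n + 1) (by omega) (by omega)
      rw [e1, e2, ← (hwin n (by omega) (by omega)).2.1, ← (hwin (n + 1) (by omega) (by omega)).2.1]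
      exact (hcut n hnTs).1
    have hTs₀ : j₀ ≤ Ts := by omega
    have hTsT : Ts ≤ T := hTs.le
    have eTs : ρt Ts = ρ Ts := hρt_eq Ts hTs₀ hTsT
    have ej : ρt j = ρ j := hρt_eq j hj₀ (by omega)
    have hposj : ∀ V, PlaqSmall (θBal F.L γ b₀ p₀ j) V → 0 < ρt j V := by
      rw [ej]; exact fun V hV => ((hwin j hj₀ (by omega)).1 V hV).1
    have hposT : ∀ U, PlaqSmall (θBal F.L γ b₀ p₀ Ts) U → 0 < ρt Ts U ∧ 0 < ρ' Ts U := by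
      rw [eTs]; exact fun U hU => (hwin Ts hTs₀ hTsT).1 U hU
    have hcT : ContinuousOn (ρt Ts) {U | PlaqSmall (θBal F.L γ b₀ p₀ Ts) U} := by
      rw [eTs]; exact (hwin Ts hTs₀ hTsT).2.2.2.2.2.2.2.1.1
    have hcT' : ContinuousOn (ρ' Ts) {U | PlaqSmall (θBal F.L γ b₀ p₀ Ts) U} := (hwin Ts hTs₀ hTsT).2.2.2.2.2.2.2.1.2
    have hver := hA j hjA Ts hjTs ρt (ρ' Ts) hρt_meas h7t hposj hposT hcT hcT' σ hσM hσb hσf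
    simp only [eTs] at hver
    obtain ⟨mfun, hmc, hmae⟩ := hver
    -- the two presentations
    obtain ⟨c', a', w₁, ha', hw₁, hbdL, hc', k₁, hk₁, hrow₁, h4L⟩ :=
      hL ν hG hCν K K' hKK' Ts T hTs hTK μ μ' ρ ρ' hanch hcut hcons hfin hwin w hw0 (hwle.trans (min_le_left _ _)) hseed j hjLj hjTs
        σ hσM hσb hσf mfun hmc hmae
    obtain ⟨c'', a'', w₂, ha'', hw₂, hbdJ, hc'', k₂, hk₂, hrow₂, h4J⟩ :=
      hJ ν hG hCν K K' hKK' Ts T hTs hTK μ μ' ρ ρ' hanch hcut hcons hfin hwin w hw0 (hwle.trans (min_le_right _ _)) hseed j hjJj hjTs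
        σ hσM hσb hσf mfun hmc hmae
    -- positivity of the window unit `D_j = β_j·θ_j²` and of the H-window `θ_j∕4`
    have hLpos : (0 : ℝ) < (F.L : ℝ) := by
      have h1L : (1 : ℝ) < (F.L : ℝ) := by exact_mod_cast F.hL.2
      linarith
    have hθj : 0 < θBal F.L γ b₀ p₀ j := T3MinimiserStabilityReduction.θBal_pos F.hL.2.le hγ hγone hb₀ p₀ j
    have hD : 0 < ((F.L : ℝ) ^ j / γ) * θBal F.L γ b₀ p₀ j ^ 2 := mul_pos (div_pos (pow_pos hLpos j) hγ) (pow_pos hθj 2)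
    have hθW : 0 ≤ θBal F.L γ b₀ p₀ j / 4 := by positivity
    -- the marginal is linear in `c′`
    have hmarg : ∀ X : GaugeField (F.P j) 0 ↥(Matrix.specialUnitaryGroup (Fin 2) ℂ),
        ((F.L : ℝ) ^ j / γ) * ∑ p, (c' + c'') p * (1 - reTr (GaugeField.plaqHol X p)) =
          ((F.L : ℝ) ^ j / γ) * ∑ p, c' p * (1 - reTr (GaugeField.plaqHol X p)) +
            ((F.L : ℝ) ^ j / γ) * ∑ p, c'' p * (1 - reTr (GaugeField.plaqHol X p)) := by
      intro X
      rw [← mul_add, ← Finset.sum_add_distrib]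
      congr 1
      exact Finset.sum_congr rfl (fun p _ => by rw [Pi.add_apply, add_mul])
    refine ⟨c' + c'', a' + a'', w₁ + w₂, add_nonneg ha' ha'', add_nonneg hw₁ hw₂, ?_,
      fun p => by rw [Pi.add_apply]; exact (abs_add_le _ _).trans (add_le_add (hc' p) (hc'' p)),
      fun b b' => k₁ b b' + k₂ b b', fun b b' => add_nonneg (hk₁ b b') (hk₂ b b'), ?_, ?_⟩
    · -- `((Ctr + εd)·x + δᴸ) + (C·x·x + δᴶ) = (Ctr + εd + C·x)·x + δ`
      have hx₁ : 0 ≤ w₁ / (((F.L : ℝ) ^ j / γ) * θBal F.L γ b₀ p₀ j ^ 2) := div_nonneg hw₁ hD.le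
      have hx₂ : 0 ≤ w₂ / (((F.L : ℝ) ^ j / γ) * θBal F.L γ b₀ p₀ j ^ 2) := div_nonneg hw₂ hD.le
      have hm₁ : min θL θJ * (w₁ / (((F.L : ℝ) ^ j / γ) * θBal F.L γ b₀ p₀ j ^ 2)) ≤ θL * (w₁ / (((F.L : ℝ) ^ j / γ) * θBal F.L γ b₀ p₀ j ^ 2)) :=
        mul_le_mul_of_nonneg_right (min_le_left _ _) hx₁
      have hm₂ : min θL θJ * (w₂ / (((F.L : ℝ) ^ j / γ) * θBal F.L γ b₀ p₀ j ^ 2)) ≤ θJ * (w₂ / (((F.L : ℝ) ^ j / γ) * θBal F.L γ b₀ p₀ j ^ 2)) :=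
        mul_le_mul_of_nonneg_right (min_le_right _ _) hx₂
      have hsplit : min θL θJ * ((w₁ + w₂) / (((F.L : ℝ) ^ j / γ) * θBal F.L γ b₀ p₀ j ^ 2)) =
          min θL θJ * (w₁ / (((F.L : ℝ) ^ j / γ) * θBal F.L γ b₀ p₀ j ^ 2)) + min θL θJ * (w₂ / (((F.L : ℝ) ^ j / γ) * θBal F.L γ b₀ p₀ j ^ 2)) := by
        rw [add_div, mul_add]
      rw [hsplit]
      linarith [hbdL, hbdJ, hm₁, hm₂]
    · intro b
      have e : (∑ b', (k₁ b b' + k₂ b b') * Real.exp (κ * (b.src.tdist b'.src : ℝ))) =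
          (∑ b', k₁ b b' * Real.exp (κ * (b.src.tdist b'.src : ℝ))) + ∑ b', k₂ b b' * Real.exp (κ * (b.src.tdist b'.src : ℝ)) := by
        rw [← Finset.sum_add_distrib]
        exact Finset.sum_congr rfl (fun b' _ => add_mul _ _ _)
      rw [e]
      exact add_le_add (hrow₁ b) (hrow₂ b)
    · intro b b' v v' U V W Z hv hv' hU hV hW hZ e1 e2 e3 e4 e5 e6
      have hvL : ‖v‖ ≤ rL * (θBal F.L γ b₀ p₀ j / 4) := hv.trans (mul_le_mul_of_nonneg_right (min_le_left _ _) hθW)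
      have hv'L : ‖v'‖ ≤ rL * (θBal F.L γ b₀ p₀ j / 4) := hv'.trans (mul_le_mul_of_nonneg_right (min_le_left _ _) hθW)
      have hvJ : ‖v‖ ≤ rJ * (θBal F.L γ b₀ p₀ j / 4) := hv.trans (mul_le_mul_of_nonneg_right (min_le_right _ _) hθW)
      have hv'J : ‖v'‖ ≤ rJ * (θBal F.L γ b₀ p₀ j / 4) := hv'.trans (mul_le_mul_of_nonneg_right (min_le_right _ _) hθW)
      have A := h4L b b' v v' U V W Z hvL hv'L hU hV hW hZ e1 e2 e3 e4 e5 e6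
      have B := h4J b b' v v' U V W Z hvJ hv'J hU hV hW hZ e1 e2 e3 e4 e5 e6
      have hsum := add_le_add A B
      rw [← add_mul, ← add_mul] at hsum
      refine le_trans ?_ hsum
      rw [hmarg Z, hmarg V, hmarg W, hmarg U]
      refine le_trans (le_of_eq ?_) (abs_add_le _ _)
      congr 1
      ring


end Summit.QuantumFields.YangMills.Theorems.OrganTangentTaylorCutHV23

end
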